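import Summits.FinalStateConjecture.FinalStateConjecture.Theses.PhotonSphereChannels
import Summits.FinalStateConjecture.FinalStateConjecture.Theorems.PhotonSphereChannelsFixedModeReduction
import Literature.Analysis.PDE.Wave1DSpatialReflection
import Summits.FinalStateConjecture.FinalStateConjecture.Theorems.PhotonSphereChannelsUniformPhotonSphereChannelsRNearLogEdgeChannels
import Summits.FinalStateConjecture.FinalStateConjecture.Theorems.PhotonSphereChannelsUniformPhotonSphereChannelsRLadderExists
import Summits.FinalStateConjecture.FinalStateConjecture.Theorems.PhotonSphereChannelsUniformPhotonSphereChannelsRPeel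
import Summits.FinalStateConjecture.FinalStateConjecture.Theorems.PhotonSphereChannelsUniformPhotonSphereChannelsRKernelOneChannelsNoMoment
import Summits.FinalStateConjecture.FinalStateConjecture.Theorems.PhotonSphereChannelsUniformPhotonSphereChannelsRResidualZero
import Summits.FinalStateConjecture.FinalStateConjecture.Theorems.PhotonSphereChannelsUniformPhotonSphereChannelsRResidualFromShift

/-!
# Line `crum-peeling-recessive-tower` for crux `UniformPhotonSphereChannelsR` (K1R,
# stmt-FinalStateConjecture-14074) — skeleton v1 (planner crux-plan, 2026-08-16)

Route `PhotonSphereChannels`, rank-2 crux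
`Summit.FinalStateConjecture.FinalStateConjecture.Theses.PhotonSphereChannels.UniformPhotonSphereChannelsR`:
the LOG-BALL two-ended channel-of-energy inequality for the Regge–Wheeler family, constant uniform
in `(s, ℓ, ρ)` for `ρ ≥ ρ₀(M) + C(M) log(ℓ+1)`.

Idea `crum-peeling-recessive-tower` (ideator 1) MERGED, as all three triagers asked, with its
sibling `wedge-identity-null-hardy` into ONE far line "peel-then-wedge":

* K1R = NEAR log-edge channels ∧ FAR log-edge channels (domain of dependence; the glue
  `uniform_of_near_far` is PROVED below, uniform version of the landed per-mode
  `Theorems.fixedModeChannels_of_near_far`);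
* NEAR = the landed per-mode theorem `Theorems.nearHalfLineChannels` with its constants made
  explicit (`ρ₀(M, ℓ) = 2M log(25600 M² B e^{3/2M})`, `B ∝ ℓ²+ℓ+1`, `c = 1/4` ⇒ `C_near = 4M`):
  `stub_nearLogEdgeChannels`;
* FAR, the open content, by PEELING: factor `−∂ₓ² + V_{s,ℓ}` along the RECESSIVE zero-energy
  Jordan chain (confluent Crum = the Riccati ladder `W_k' + W_k² = U_k`, `U_{k+1} = 2W_k² − U_k`,
  `x W_k → −(ℓ−k)`, `U_0 = V`, residual `Q_ℓ := U_ℓ`): the energy-level Darboux maps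
  `ψ ↦ (∂ₓ − W_k) ∂ₜ⁻¹ ψ` are exact isometries killing one tower element per rung, so that
  `dist²_far(ψ, towers) = inf_c E_{Q_ℓ}(φ − c u_Q)` and the channel energies are unchanged
  (`stub_peel`); what is left is a kernel-ONE far channel inequality for a SUB-HARDY potential,
  closed in three lines by the wedge identity + Hardy on the two null rays
  (`stub_kernelOneChannels`, constant `1/2` once `sup_t t² Q(x_f+t) ≤ 1/16`); the whole
  difficulty of K1R-far is the ODE statement that the explicit function `Q_ℓ` IS sub-Hardy beyond a
  logarithmically receding edge (`stub_residualSubHardy`, the HARDEST stub; numerics of four seats: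
  Hardy-sufficient edge `x_H(ℓ) = 2.6M + 2.0M ln ℓ` for `ℓ = 4 … 1024`, translating profile
  `Q_ℓ(2M ln ℓ + δ) → q(δ)`), after the ladder exists at all on a neighbourhood of the far half-line
  (`stub_ladderExists`: every partner potential keeps a zero-free recessive seed).

Registered stubs (v1/v2): `stub_nearLogEdgeChannels` (M), `stub_ladderExists` (L),
`stub_residualSubHardy` (XL, hardest), `stub_peel` (L), `stub_kernelOneChannelsNoMoment` (L).
STATUS (lead-0, 2026-08-16, skeleton v2): N, E, P, K′ are LANDED (Theorems/PhotonSphereChannels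
UniformPhotonSphereChannelsR{NearLogEdgeChannels,LadderExists,Peel,KernelOneChannelsNoMoment}.lean,
p89251/p94328/p94517/p95960) and wired in below; v2's only `sorry` was `stub_residualSubHardy`
(first-moment clause dropped).
STATUS (continuation lead c1, 2026-08-16, skeleton v3): R is RESHAPED into three registered stubs —
`stub_residualZero` (R₀: ℓ = 0, size S), `stub_shiftBounds` (R_D: uniform two-sided bounds on the last
shift `D = −1/W_{ℓ−1}`, size XL, THE hard core, held by the lead) and `stub_residualFromShift`
(R_D ⇒ R: terminal identity + mean value + derivative test, size M) — with the reassembly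
`residualSubHardy_of_stubs` PROVED below (same signature as v2's R); the only `sorry`s of this file are
those three stubs.
PROVED here: `farLogEdgeChannels_of` (the four far stubs ⇒ the uniform far half, incl. the
infinite-energy case via `Literature.Analysis.PDE.wave1D_farEnergy_eq_top_of_initial_eq_top`),
`uniform_of_near_far` (near ∧ far ⇒ K1R: `ρ₀ = max`, `C = max`, `c = min`, product kernel,
super-additivity of monotone `liminf`s), `uniformR_of_statements` (the five stub STATEMENTS, as
hypotheses, imply K1R's body) and the composition `UniformPhotonSphereChannelsR_of` (closed term
over the five `stub_*`; concludes the crux BY NAME — the only theorem here that does).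

All stub signatures are stated over EXISTING declarations only (Mathlib +
`Literature.Geometry.Lorentzian.ReggeWheeler.*`), the ladder being spelled out as four clauses on
`W U : ℕ → ℝ → ℝ` and a left end `a`; stub workers import `Literature` + the route file only.

DISPROOF USED (`Cruxes/UniformPhotonSphereChannelsR/Disproof.lean` v2, cdisprove, sorry-free;
landed `Theorems/UniformPhotonSphereChannelsR/Negative/FarFrozenPackets.lean`):
`logFree_imp_uniformR` (C = 0 is the refuted K1 — every proof must use the log-ball): honoured,
`C > 0` enters at `stub_nearLogEdgeChannels` (C_near = 4M, the landed constant) and at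
`stub_residualSubHardy` (C_far, measured 2M); `channelsAt_mono`/`exists_mono`: used implicitly
(`max`/`min` of constants in the two glue theorems); `far_frozen_channel_small` /
`farAbsorption_of_uniformR` (far-edge rest packets radiate arbitrarily little ⇒ K1R-far ⟺ the
towers absorb them): consistent — a rest packet of width `w ≫ 1/ω` is locally a tower (finding
4(i)) and its peeled image carries only `O(Q_ℓ)`-small energy, which `stub_kernelOneChannels`
charges at rate `≥ 1/2`; the Negative lemmas `FrozenPacket.far_energy_le_at/frozen_packet_far`
refute no stub (they are consequences every channel inequality must tolerate; no stub asserts a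
fixed-ball or log-free uniform statement = negatives index stmt-10045).
-/

noncomputable section

set_option linter.dupNamespace false

namespace Summit.FinalStateConjecture.FinalStateConjecture.Cruxes.UniformPhotonSphereChannelsR.CrumPeelingRecessiveTower

open Literature.Geometry.Lorentzian Literature.Geometry.Lorentzian.ReggeWheeler
open Summit.FinalStateConjecture.FinalStateConjecture.Theses.PhotonSphereChannels
open Summit.FinalStateConjecture.FinalStateConjecture.Theorems
open Literature.Analysis.PDE
open MeasureTheory Filter Set Topology
open scoped ENNReal

/-! ## §1 Registered stubs -/

/-- **Stub N — near log-edge channels, uniform (size M).**  The NEAR (horizon-side) half-line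
channel inequality with constants uniform in `(s, ℓ, ρ)` on the log-ball: `∃ ρ₀(M), C(M), c(M)`
such that for every tortoise radius function, `s ≤ 2`, `ℓ ≥ s`, `ρ ≥ ρ₀ + C log(ℓ+1)` and every
global Regge–Wheeler solution `ψ`,
`c · inf_{p ∈ P_near(ρ)} E_{x < xc−ρ}[ψ − p](0) ≤ liminf_{+∞} E_near + liminf_{−∞} E_near`,
`E_near(t)` the energy on `{x < xc − ρ − |t|}`, `P_near` the `t`-polynomial `C²` solutions on the
near cone.  This is the landed PER-MODE theorem `Theorems.nearHalfLineChannels` (p73389) with its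
explicit witnesses exposed: there `c = 1/4` and `ρ₀(M, ℓ) = max 0 (2M log(25600 M² B e^{3/2M}))`,
`B = (ℓ(ℓ+1)+1)(2M)⁻³ e^{(r*(3M)−2M)/2M}`, i.e. `ρ₀(M,ℓ) ≤ ρ₀'(M) + 4M log(ℓ+1)` — so `C = 4M`
works (the redshift e-fold `1/κ`; `C ≥ 4M` is NECESSARY on this side by the frozen packets of
`Theorems.not_UniformPhotonSphereChannels`, Disproof §(a)).  Proof = the landed proof with the
constant bookkeeping made uniform (same file, same lemmas); no new mathematics, but not a one-liner
(the per-mode statement hides its witnesses in `∃`). -/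
theorem stub_nearLogEdgeChannels :
    ∀ M : ℝ, 0 < M → ∃ ρ₀ : ℝ, 0 ≤ ρ₀ ∧ ∃ C : ℝ, 0 ≤ C ∧ ∃ c : ℝ, 0 < c ∧
      ∀ (r : ℝ → ℝ) (xc : ℝ), IsTortoiseRadius M r xc → ∀ (s ℓ : ℕ), s ≤ 2 → s ≤ ℓ →
        ∀ ρ : ℝ, ρ₀ + C * Real.log ((ℓ : ℝ) + 1) ≤ ρ →
          ∀ ψ : ℝ → ℝ → ℝ, IsRWSolution M s ℓ r ψ →
            ENNReal.ofReal c *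
                (⨅ p ∈ {p : ℝ → ℝ → ℝ |
                    IsSolutionOn (linePotential M s ℓ r) p {z : ℝ × ℝ | z.2 < xc - ρ - |z.1|} ∧
                      IsPolynomialInTimeOn p {z : ℝ × ℝ | z.2 < xc - ρ - |z.1|}},
                  ∫⁻ x in Set.Iio (xc - ρ), ENNReal.ofReal
                    (energyDensity (linePotential M s ℓ r) (fun t y => ψ t y - p t y) 0 x))
              ≤ liminf (fun t => ∫⁻ x in Set.Iio (xc - ρ - |t|),
                    ENNReal.ofReal (energyDensity (linePotential M s ℓ r) ψ t x)) atTop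
                + liminf (fun t => ∫⁻ x in Set.Iio (xc - ρ - |t|),
                    ENNReal.ofReal (energyDensity (linePotential M s ℓ r) ψ t x)) atBot :=
  Summit.FinalStateConjecture.FinalStateConjecture.Theorems.CrumPeelingRecessiveTower.stub_nearLogEdgeChannels

/-- **Stub E — the recessive Riccati ladder exists on a neighbourhood of the far half-line
(size L).**  For `x_f = xc + ρ` beyond a log edge `ρ ≥ ρ₁(M) + C₁(M) log(ℓ+1)` there are
superpotentials `W 0, …, W (ℓ−1)` and partner potentials `U 0 = V_{s,ℓ}, U 1, …, U ℓ` on some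
`(a, ∞) ∋ x_f` with `W_k' + W_k² = U_k`, `U_{k+1} = 2W_k² − U_k` (`= W_k² − W_k'`, the Darboux
partner) and the RECESSIVE normalisation `x · W_k(x) → −(ℓ − k)` (`W_k = u_k'/u_k` for the
zero-energy solution `u_k ∼ x^{−(ℓ−k)}` of `U_k` decaying at `𝓘`; this pins `W_k` uniquely), the
last potential `Q_ℓ := U ℓ` being `C¹` there.  Content: the recessive solution of `U_k` exists near
`+∞` (`U_k = λ(λ+1)x⁻²·(1 + O(M log x/x))`, `λ = ℓ − k`, Levinson/Volterra as in
`Literature.Analysis.ODE.RecessiveSolution`) and continues leftwards as long as it is zero-free;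
the claim is that NO seed of the chain vanishes on `[x_f − ε, ∞)` once `x_f` is beyond the log edge
(sufficient: `U_k > 0` there, since a positive convex solution tending to `0` cannot vanish).
Numerics (card + TRIAGE-r1-3 App. A): no pole of any `W_k` on `x ≥ xc + 1` for `ℓ ≤ 128`,
intermediate `U_k − λ(λ+1)/x² > 0` (accumulation `≈ 4Mλ² ln(ℓ/λ)/x³ > 0`, first order in `M`:
TRIAGE-r1-1, TRIAGE-r1-2 E2).  Why it might fail: a zero of a deep-rung seed inside `[x_f, 20M]` for very
large `ℓ` (second-order-in-`M` terms); then the line survives with a larger `C₁`.  `ℓ = 0`: no rung,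
`U 0 = V`. -/
theorem stub_ladderExists :
    ∀ M : ℝ, 0 < M → ∃ ρ₁ : ℝ, 0 ≤ ρ₁ ∧ ∃ C₁ : ℝ, 0 ≤ C₁ ∧
      ∀ (r : ℝ → ℝ) (xc : ℝ), IsTortoiseRadius M r xc → ∀ (s ℓ : ℕ), s ≤ 2 → s ≤ ℓ →
        ∀ ρ : ℝ, ρ₁ + C₁ * Real.log ((ℓ : ℝ) + 1) ≤ ρ →
          ∃ (W U : ℕ → ℝ → ℝ) (a : ℝ), a < xc + ρ ∧
            (∀ x, a < x → U 0 x = linePotential M s ℓ r x) ∧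
            (∀ k, k < ℓ → ∀ x, a < x → HasDerivAt (W k) (U k x - W k x ^ 2) x) ∧
            (∀ k, k < ℓ → ∀ x, a < x → U (k + 1) x = 2 * W k x ^ 2 - U k x) ∧
            (∀ k, k < ℓ → Tendsto (fun x => x * W k x) atTop (𝓝 ((k : ℝ) - ℓ))) ∧
            ContDiffOn ℝ 1 (U ℓ) (Set.Ioi a) :=
  Summit.FinalStateConjecture.FinalStateConjecture.Theorems.CrumPeelingRecessiveTower.stub_ladderExists

/-! ### Stub R, RESHAPED by the continuation lead c1 (2026-08-16) into R₀ ∧ R_D ∧ (R_D ⇒ R)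

`stub_residualSubHardy` (v1/v2: ONE sorry) asked, for the recessive ladder `(W, U, a)` of
`V_{s,ℓ}` and the edge `x_f = xc + ρ` beyond `ρ₂ + C₂ log(ℓ+1)`, that the peeled residual
`Q_ℓ = U ℓ` be `≥ 0` near `[x_f, ∞)`, non-increasing on `[x_f, ∞)` and `1/16`-sub-Hardy.  By the
TERMINAL IDENTITY `U ℓ = 2W² − U (ℓ−1) = (1 − D′)/D²`, `W = W (ℓ−1)`, `D = −1/W`,
`D′ = (U(ℓ−1) − W²)/W²` (landed: `Literature.Analysis.ODE.RiccatiCrumShift`, seat 3, p95597), all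
three clauses are read off the LAST SHIFT `D` and its first two derivatives; the statement is now
split into
* `stub_residualZero` (R₀, size S): the rung-free case `ℓ = 0` (`s = 0`, `U 0 = V_{0,0} = (1−2M/r)2M/r³`);
* `stub_shiftBounds` (R_D, size XL — THE HARD CORE, held by the lead): for `ℓ ≥ 1`, division-free
  two-sided bounds on `W (ℓ−1)`, `U (ℓ−1)` on the log edge — `W < 0`, `D′ ≤ 1` near `[x_f,∞)`,
  `1/2 ≤ D′`, `1 − D′ ≤ 1/64` and `(U ℓ)′ ≤ 0` on `[x_f, ∞)`;
* `stub_residualFromShift` (size M): the calculus `R_D ⇒ R` for `ℓ ≥ 1` (terminal identity, mean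
  value inequality, derivative test), abstract in `(W, U, ℓ, a, a′, x_f)`;
and `residualSubHardy_of_stubs` (PROVED below) reassembles the registered v2 signature of R from the
three (`ρ₂ = max ρ₃ ρ₄`, `C₂ = C₃`; case split `ℓ = 0 ∨ 1 ≤ ℓ`).  Numerics and structure behind R_D:
crux evidence `R-dossier.md` (lead-0), `R-blueprint-seat3.md` v3.1 (seat 3), `R-structure-c1.md`
(this seat: exact shift recursion `a_{k+1} = a_k + M/λ + M/(λ−1)`, `a_{ℓ−1} = M(2H_ℓ − 1 − 1/ℓ) + a_0`,
power-series form of the rung map, `G₂ → 2a − 5M`, critical-radius obstruction for blind majorants). -/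

/-- **Stub R₀ — the rung-free case `ℓ = 0` (size S).**  For `ℓ = 0` (hence `s = 0`) there is no
rung: `U 0 = V_{0,0} = (1 − 2M/r)·2M/r³` on `(a, ∞)`.  It is `≥ 0` (as `r > 2M`), non-increasing in
`x` wherever `r ≥ 8M/3` (so on `[xc + ρ, ∞)`, `ρ ≥ 0`, since `r(xc) = 3M` and `r` increases), and
`t²·V_{0,0}(x_f + t) ≤ 2M t²/r(x_f+t)³ ≤ 54M t²/(3 r(x_f) + t)³ ≤ 8M/(3 r(x_f)) ≤ 1/16` once
`r(x_f) ≥ 128M/3`, which `ρ ≥ ρ₄ := 130M` guarantees (`r(xc + ρ) ≥ 3M + ρ/3` from `r′ ≥ 1/3` on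
`r ≥ 3M`).  Leans on `IsTortoiseRadius.{two_mul_lt, hasDerivAt, center, strictMono}`,
`rwPotential_zero`, `linePotential_nonneg`. -/
theorem stub_residualZero :
    ∀ M : ℝ, 0 < M → ∃ ρ₄ : ℝ, 0 ≤ ρ₄ ∧
      ∀ (r : ℝ → ℝ) (xc : ℝ), IsTortoiseRadius M r xc →
        ∀ ρ : ℝ, ρ₄ ≤ ρ → ∀ (U : ℕ → ℝ → ℝ) (a : ℝ), a < xc + ρ →
          (∀ x, a < x → U 0 x = linePotential M 0 0 r x) →
          (∃ a' : ℝ, a ≤ a' ∧ a' < xc + ρ ∧ ∀ x, a' < x → 0 ≤ U 0 x) ∧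
          AntitoneOn (U 0) (Set.Ici (xc + ρ)) ∧
          ∀ t : ℝ, 0 < t → t ^ 2 * U 0 (xc + ρ + t) ≤ 1 / 16 :=
  Summit.FinalStateConjecture.FinalStateConjecture.Theorems.CrumPeelingRecessiveTower.stub_residualZero

/-! ### Stub R_D, RESHAPED by the continuation lead c2 (2026-08-16) into five registered stubs and a
PROVED composition (skeleton v4)

`stub_shiftBounds` (v3: ONE sorry, the hard core) asks, for `ℓ ≥ 1` and the recessive ladder
`(W, U, a)` of `V_{s,ℓ}`, division-free two-sided bounds on the last Riccati variable
`W (ℓ−1)` and its partner `U (ℓ−1)` beyond a log edge.  The chain is the SUSY chain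
`W_{k+1}′ + W_{k+1}² = W_k² − W_k′` with recessive data `x·W_k → −λ_k`, `λ_k = ℓ − k`; writing
`W_k = −(λ_k/r)·ω_k(M/r)` the unknowns `ω_k(w) = Σ_n Ω_{k,n} wⁿ` (`Ω_{k,0} = 1`) are power series in
`w = M/r` whose coefficients solve an EXPLICIT TRIANGULAR RATIONAL RECURSION (dimensionless; this
seat's `calc/chain.py` = c1's shift law to all digits):
* rung 0:    `ℓ² ω₀² + ℓ f (w ω₀)′ = f (L + β w)`, `f = 1 − 2w`, `L = ℓ(ℓ+1)`, `β = 2(1 − s²)`;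
* rung map:  `(λ−1)² ν² + (λ−1) f (w ν)′ = λ² ω² − λ f (w ω)′` (`ω = ω_k`, `ν = ω_{k+1}`, `λ = ℓ − k ≥ 2`),
and `g_k := 1/ω_k` (so that `D_k := −λ_k/W_k = r·g_k(M/r)`) carries the transport structure:
`g_k = 1 − ã_k w + O(B_k^{n−1}) wⁿ`, `ã_{ℓ−1} ≈ 2 ln ℓ` (the log-ball, derived).  The five stubs:
* `stub_coeffExists` (S): arrays `Ω G : ℕ → ℕ → ℝ` solving the recursion and `g_k ω_k = 1` exist;
* `stub_coeffMajorant` (XL — THE HARD CORE, held by the lead; = Theorem A of c1's plan with its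
  exported form made robust): uniformly in `s ≤ 2`, `ℓ ≥ 1`, `k ≤ ℓ−1`:
  `|G_{k,1}| ≤ R`, `|G_{k,n}| ≤ R^{n−1}` (`n ≥ 2`), `|Ω_{k,n}| ≤ Rⁿ`, `R = K(1 + log(ℓ+1))`;
* `stub_seriesChain` (L): for `r > 2RM` the analytic germs `Wa_k = −(λ_k/r)·Σ Ω_{k,n}(M/r)ⁿ` solve the
  chain (`Wa_k′ = Ua_k − Wa_k²`, `Ua_0 = V`, `Ua_{k+1} = 2Wa_k² − Ua_k`) with `x·Wa_k → k − ℓ`;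
* `stub_recessiveUnique` (M): two recessive ladders over the same `V` coincide (`d′ = −(W₁+W₂)d`,
  `x·W_i → −λ ≤ −1` ⇒ `d ≡ 0`), so the hypothesised ladder IS the analytic one where both live;
* `stub_shiftFromCoeffs` (L; = Theorems B+D): for `r ≥ 200 R M` the three registered clause groups
  follow from the coefficient bounds by geometric tail estimates (`D = r g`, `1 − D′ = 2w + O(Rw²)`,
  `D″ > 0`).
`stub_shiftBounds` is PROVED below from the five (`ρ₃ = 600KM + 1`, `C₃ = 600KM`; `r(x) ≥ 3M + (x−xc)/3`,
`Theorems.tortoise_ge_third`).  The recursion clauses are spelled out identically in every stub over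
Mathlib only (`Finset.range` convolutions); `n − 1` is truncated subtraction, harmless because it is
multiplied by `n`. -/

/-- **Stub F — the coefficient arrays exist (size S).**  For `ℓ ≥ 1` and any `s` there are
`Ω G : ℕ → ℕ → ℝ` with `Ω k 0 = G k 0 = 1`, `Σ_{i ≤ n} G k i · Ω k (n−i) = [n = 0]` (so `g_k = 1/ω_k` as
formal power series), `Ω 0` solving the rung-0 recursion and `Ω (k+1)` the rung map from `Ω k` for
`k + 2 ≤ ℓ` (`λ = ℓ − k ≥ 2`).  Construction: the recursions are triangular — at order `n ≥ 1` the new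
coefficient enters linearly with pivot `ℓ(2ℓ+1+n)` resp. `(ℓ−k−1)(2(ℓ−k)−1+n) ≠ 0`, order `0` holds by
the normalisation — so define `Ω 0 n`, then `Ω (k+1) n`, by strong recursion on `n` (outer recursion on
`k`; `Ω k := [n = 0]` for `k ≥ ℓ`), and `G k` by `G k 0 = 1`, `G k n = −Σ_{1 ≤ i ≤ n} Ω k i · G k (n−i)`.
Leans on: Mathlib only (`Nat.strongRec`/`Nat.rec`, `Finset.sum_range_succ`). -/
theorem stub_coeffExists :
    ∀ (s ℓ : ℕ), 1 ≤ ℓ → ∃ (Ω G : ℕ → ℕ → ℝ),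
      (∀ k, Ω k 0 = 1) ∧ (∀ k, G k 0 = 1) ∧
      (∀ k n, ∑ i ∈ Finset.range (n + 1), G k i * Ω k (n - i) = if n = 0 then 1 else 0) ∧
      (∀ n, (ℓ : ℝ) ^ 2 * ∑ i ∈ Finset.range (n + 1), Ω 0 i * Ω 0 (n - i)
          + (ℓ : ℝ) * (((n : ℝ) + 1) * Ω 0 n - 2 * (n : ℝ) * Ω 0 (n - 1))
          = (if n = 0 then (ℓ : ℝ) * ((ℓ : ℝ) + 1)
             else if n = 1 then 2 * (1 - (s : ℝ) ^ 2) - 2 * ((ℓ : ℝ) * ((ℓ : ℝ) + 1))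
             else if n = 2 then -(4 * (1 - (s : ℝ) ^ 2)) else 0)) ∧
      (∀ k, k + 2 ≤ ℓ → ∀ n,
          ((ℓ : ℝ) - k - 1) ^ 2 * ∑ i ∈ Finset.range (n + 1), Ω (k + 1) i * Ω (k + 1) (n - i)
          + ((ℓ : ℝ) - k - 1) * (((n : ℝ) + 1) * Ω (k + 1) n - 2 * (n : ℝ) * Ω (k + 1) (n - 1))
          = ((ℓ : ℝ) - k) ^ 2 * ∑ i ∈ Finset.range (n + 1), Ω k i * Ω k (n - i)
          - ((ℓ : ℝ) - k) * (((n : ℝ) + 1) * Ω k n - 2 * (n : ℝ) * Ω k (n - 1))) := by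
  sorry

/-- **Stub A — uniform majorant for the coefficient chain (size XL; THE HARD CORE of the line,
held by the lead).**  There is an absolute `K ≥ 1` such that for all `s ≤ 2`, `ℓ ≥ max(s, 1)` and all
arrays `(Ω, G)` as in `stub_coeffExists`, every rung `k ≤ ℓ − 1` obeys, with
`R := K (1 + log(ℓ+1))`:  `|G k 1| ≤ R`, `|G k n| ≤ R^{n−1}` (`n ≥ 2`) and `|Ω k n| ≤ Rⁿ`.
WHY TRUE: exact rationals (this seat, `calc/probe3.py`, `s ≤ 2`, `ℓ ≤ 128`, `n ≤ 30`): the envelope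
`max(|G_{k,1}|, max_n |G_{k,n}|^{1/(n−1)})` is `≤ 1.87` at every rung with `ã_k ≤ 0` (radius = the
horizon `w = 1/2`) and `≤ 1.4 (ã_k + 2)` at the late rungs, worst at the LAST rung, mode `n = 2`
(`G_{ℓ−1,2} = 2ã − 1 + o(1)`), `ã_{ℓ−1} = 2H_ℓ − 2 − 1/ℓ + (2ℓ+β)/(2ℓ(ℓ+1)) ≈ 2 ln ℓ` (EXACT shift law,
c1; reproduced); so `K ≈ 5` holds and the provable scheme gives `K ≈ 30–60`.  PROOF SHAPE (c1's
Theorem A, `Cruxes/…/NOTES.md` §§7–15, R-proof-c1): in `g = 1/ω` variables the flat chain is the fixed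
family `g = 1 − ãw` (all `G_n = 0`, `n ≥ 2`), the rung map linearised about it is TRIANGULAR with
diagonal `μ_λ(n) = λ(2λ−1−n)/((λ−1)(2λ−1+n))` and, from the rung where `ã ≥ 0`, ENTRYWISE NONNEGATIVE
with nonnegative forcing, so the profile `Ĝ_n = (2/(n−1)) θ^{1−n} B^{n−1}` (`B = ã + K₀`, `θ < 1/2`) is a
strict supersolution (Lemma 1, margin `(1−2θ)/(1−θ)`); the exact remainder (`E`-equation, q-form
`q[2λ² − (3λ−1)𝔞] + (λ−1) f w g q′ + λ(λ−𝔞) q² = (2λ−1)(𝔞−1)`, `h = g(1+q)`) is `O(1/B)·room`; high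
modes `n > (2λ−1)²` (where `|μ| ≤ λ/(λ−1)`) are paid by a rung-dependent `θ_{k+1} = θ_k(1 − 2/(2λ_k−1)²)`
(bounded total loss `0.63`); rung 0 has the `ℓ`-free majorant `M_n` (A0).  The exported form absorbs
`2/(n−1) ≤ 2^{n−1}` into `R = 4B/θ_final`, and `|Ω_n| ≤ (3R)ⁿ` follows from `ω = 1/g` by the inversion
majorant.  Why it might fail: only through constants (the statement is `∃ K`). -/
theorem stub_coeffMajorant :
    ∃ K : ℝ, 1 ≤ K ∧ ∀ (s ℓ : ℕ), s ≤ 2 → s ≤ ℓ → 1 ≤ ℓ → ∀ (Ω G : ℕ → ℕ → ℝ),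
      (∀ k, Ω k 0 = 1) → (∀ k, G k 0 = 1) →
      (∀ k n, ∑ i ∈ Finset.range (n + 1), G k i * Ω k (n - i) = if n = 0 then 1 else 0) →
      (∀ n, (ℓ : ℝ) ^ 2 * ∑ i ∈ Finset.range (n + 1), Ω 0 i * Ω 0 (n - i)
          + (ℓ : ℝ) * (((n : ℝ) + 1) * Ω 0 n - 2 * (n : ℝ) * Ω 0 (n - 1))
          = (if n = 0 then (ℓ : ℝ) * ((ℓ : ℝ) + 1)
             else if n = 1 then 2 * (1 - (s : ℝ) ^ 2) - 2 * ((ℓ : ℝ) * ((ℓ : ℝ) + 1))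
             else if n = 2 then -(4 * (1 - (s : ℝ) ^ 2)) else 0)) →
      (∀ k, k + 2 ≤ ℓ → ∀ n,
          ((ℓ : ℝ) - k - 1) ^ 2 * ∑ i ∈ Finset.range (n + 1), Ω (k + 1) i * Ω (k + 1) (n - i)
          + ((ℓ : ℝ) - k - 1) * (((n : ℝ) + 1) * Ω (k + 1) n - 2 * (n : ℝ) * Ω (k + 1) (n - 1))
          = ((ℓ : ℝ) - k) ^ 2 * ∑ i ∈ Finset.range (n + 1), Ω k i * Ω k (n - i)
          - ((ℓ : ℝ) - k) * (((n : ℝ) + 1) * Ω k n - 2 * (n : ℝ) * Ω k (n - 1))) →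
      ∀ k, k + 1 ≤ ℓ →
        |G k 1| ≤ K * (1 + Real.log ((ℓ : ℝ) + 1)) ∧
        (∀ n, 2 ≤ n → |G k n| ≤ (K * (1 + Real.log ((ℓ : ℝ) + 1))) ^ (n - 1)) ∧
        (∀ n, |Ω k n| ≤ (K * (1 + Real.log ((ℓ : ℝ) + 1))) ^ n) := by
  sorry

/-- **Stub C₁ — the analytic germs solve the chain (size L).**  Let `Ω : ℕ → ℕ → ℝ` satisfy
`Ω k 0 = 1`, `|Ω k n| ≤ Rⁿ` (`R ≥ 1`, `k + 1 ≤ ℓ`), the rung-0 recursion and the rung maps (as in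
`stub_coeffExists`).  For a tortoise radius function `r` put `Wa k x := −((ℓ − k)/r x) · Σ' n, Ω k n (M/r x)ⁿ`
(absolutely convergent for `r x > 2RM`: ratio `≤ 1/2`), `Ua 0 := V_{s,ℓ}`, `Ua (k+1) := 2 Wa_k² − Ua k`.  Then
for `k + 1 ≤ ℓ`: `HasDerivAt (Wa k) (Ua k x − (Wa k x)²) x` wherever `r x > 2RM`, and `x · Wa k x → k − ℓ`.
Mechanism: with `w = M/r`, `dw/dx = −(1 − 2M/r) w²/M` (`IsTortoiseRadius.hasDerivAt`), term-wise
differentiation (`hasDerivAt_tsum_of_isPreconnected` on `{|w| < 1/(2R)}`, or `Literature.Analysis.ODE.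
hasDerivAt_cseries` + `HasDerivAt.real_of_complex`) gives `Wa_k′ = λ_k (1−2M/r) w² (wω_k)′(w)/M²` and
`Wa_k² = λ_k² w² ω_k(w)²/M²`; the Cauchy product (`tsum_mul_tsum_eq_tsum_sum_antidiagonal_of_summable_norm`,
`Finset.Nat.sum_antidiagonal_eq_sum_range_succ_mk`) turns the coefficient recursions into the function
identities `ℓ²ω₀² + ℓ f (wω₀)′ = f(L + βw)` (⟺ `Wa₀′ + Wa₀² = V`, `V = f(Lw² + βw³)/M²`,
`ReggeWheeler.rwPotential`) and `(λ−1)²ν² + (λ−1) f (wν)′ = λ²ω² − λ f (wω)′`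
(⟺ `Wa_{k+1}′ + Wa_{k+1}² = Wa_k² − Wa_k′`); induction on `k` with `Ua (k+1) = 2Wa_k² − Ua k` gives
`Wa_k′ = Ua_k − Wa_k²`.  The limit: `x/r x → 1` (`Theorems.tortoise_far_asymptotics`: `0 ≤ x − xc + 3M − r ≤
6M log(1 + (x−xc)/9M)`, `IsTortoiseRadius.tendsto_atTop`) and `ω_k(w) → Ω k 0 = 1` as `w → 0`.
No hypothesis on `s` is needed (the rung-0 identity holds for every `s`). -/
theorem stub_seriesChain :
    ∀ (M : ℝ) (r : ℝ → ℝ) (xc : ℝ), IsTortoiseRadius M r xc → ∀ (s ℓ : ℕ),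
      ∀ (Ω : ℕ → ℕ → ℝ) (R : ℝ), 1 ≤ R → (∀ k, Ω k 0 = 1) → (∀ k, k + 1 ≤ ℓ → ∀ n, |Ω k n| ≤ R ^ n) →
      (∀ n, (ℓ : ℝ) ^ 2 * ∑ i ∈ Finset.range (n + 1), Ω 0 i * Ω 0 (n - i)
          + (ℓ : ℝ) * (((n : ℝ) + 1) * Ω 0 n - 2 * (n : ℝ) * Ω 0 (n - 1))
          = (if n = 0 then (ℓ : ℝ) * ((ℓ : ℝ) + 1)
             else if n = 1 then 2 * (1 - (s : ℝ) ^ 2) - 2 * ((ℓ : ℝ) * ((ℓ : ℝ) + 1))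
             else if n = 2 then -(4 * (1 - (s : ℝ) ^ 2)) else 0)) →
      (∀ k, k + 2 ≤ ℓ → ∀ n,
          ((ℓ : ℝ) - k - 1) ^ 2 * ∑ i ∈ Finset.range (n + 1), Ω (k + 1) i * Ω (k + 1) (n - i)
          + ((ℓ : ℝ) - k - 1) * (((n : ℝ) + 1) * Ω (k + 1) n - 2 * (n : ℝ) * Ω (k + 1) (n - 1))
          = ((ℓ : ℝ) - k) ^ 2 * ∑ i ∈ Finset.range (n + 1), Ω k i * Ω k (n - i)
          - ((ℓ : ℝ) - k) * (((n : ℝ) + 1) * Ω k n - 2 * (n : ℝ) * Ω k (n - 1))) →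
      ∀ (Wa Ua : ℕ → ℝ → ℝ),
        (∀ k x, Wa k x = -(((ℓ : ℝ) - k) / r x) * ∑' n, Ω k n * (M / r x) ^ n) →
        (∀ x, Ua 0 x = linePotential M s ℓ r x) →
        (∀ k x, Ua (k + 1) x = 2 * Wa k x ^ 2 - Ua k x) →
        (∀ k, k + 1 ≤ ℓ → ∀ x, 2 * R * M < r x → HasDerivAt (Wa k) (Ua k x - Wa k x ^ 2) x) ∧
        (∀ k, k + 1 ≤ ℓ → Tendsto (fun x => x * Wa k x) atTop (𝓝 ((k : ℝ) - ℓ))) := by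
  sorry

/-- **Stub C₂ — uniqueness of the recessive ladder (size M).**  Two Riccati–Crum ladders
`(W, U)`, `(W', U')` on `(X, ∞)` over the SAME seed potential (`U 0 = U' 0 = V` there), with the same
rung laws (`W_k′ = U_k − W_k²`, `U_{k+1} = 2W_k² − U_k`) and the same recessive normalisation
`x·W_k, x·W'_k → k − ℓ` (`k < ℓ`), coincide on `(X, ∞)`.  Induction on `k`: if `U k = U' k` on `(X,∞)` then
`d := W k − W' k` solves `d′ = −(W k + W' k)·d` there, so `d·exp(∫(W k + W' k))` is constant
(product rule); if `d(x₀) ≠ 0` then `|d(x)| = |d(x₀)| exp(∫_{x₀}^x −(W k + W' k))` with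
`−(W k + W' k)(t) ≥ (2(ℓ−k) − 1)/t ≥ 1/t` for large `t`, forcing `|d(x)| → ∞`, while `d = W k − W' k → 0`
(both are `(k−ℓ + o(1))/x`): contradiction; hence `W k = W' k`, and `U (k+1) = U' (k+1)`.  (No
Picard–Lindelöf needed.)  Leans on: Mathlib (`HasDerivAt.mul`, `Real.exp`, `integral_hasDerivAt…` or the
ODE `(d·E)′ = 0` ⇒ constant via `is_const_of_deriv_eq_zero` on an interval / `Convex.is_const_of_fderivWithin_eq_zero`). -/
theorem stub_recessiveUnique :
    ∀ (ℓ : ℕ) (V : ℝ → ℝ) (W U W' U' : ℕ → ℝ → ℝ) (X : ℝ),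
      (∀ x, X < x → U 0 x = V x) → (∀ x, X < x → U' 0 x = V x) →
      (∀ k, k < ℓ → ∀ x, X < x → HasDerivAt (W k) (U k x - W k x ^ 2) x) →
      (∀ k, k < ℓ → ∀ x, X < x → HasDerivAt (W' k) (U' k x - W' k x ^ 2) x) →
      (∀ k, k < ℓ → ∀ x, X < x → U (k + 1) x = 2 * W k x ^ 2 - U k x) →
      (∀ k, k < ℓ → ∀ x, X < x → U' (k + 1) x = 2 * W' k x ^ 2 - U' k x) →
      (∀ k, k < ℓ → Tendsto (fun x => x * W k x) atTop (𝓝 ((k : ℝ) - ℓ))) →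
      (∀ k, k < ℓ → Tendsto (fun x => x * W' k x) atTop (𝓝 ((k : ℝ) - ℓ))) →
      ∀ k, k < ℓ → ∀ x, X < x → W k x = W' k x ∧ U k x = U' k x := by
  sorry

/-- **Stub B — the shift bounds from the coefficient bounds (size L; Theorems B+D of c1's plan).**
Let `G Ω : ℕ → ℝ` with `G 0 = Ω 0 = 1`, `|G 1| ≤ R`, `|G n| ≤ R^{n−1}` (`n ≥ 2`), `|Ω n| ≤ Rⁿ`, `R ≥ 1`,
`Σ_{i≤n} G i · Ω (n−i) = [n = 0]`; let `r` be a tortoise radius function and `W, U : ℝ → ℝ` with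
`W x = −(1/r x)·Σ' Ω n (M/r x)ⁿ` and `W′ = U − W²` on `(X, ∞)`, where `r > 200RM`.  Then on `(X, ∞)`:
`W < 0`, `U ≤ 2W²`; `W² ≤ 2(U − W²)`, `64(2W² − U) ≤ W²`; and `U` is differentiable with
`4W(U − W²) − U′ ≤ 0`.  Mechanism (`w = M/r ≤ 1/(200R)`, `t = Rw ≤ 1/200`): the Cauchy product of the
inversion relation gives `(Σ Ω n wⁿ)(Σ G n wⁿ) = 1`, so `W = −1/D`, `D := r·g(w)`, `g = Σ G n wⁿ ∈ [1 − t − t², 1 + t + t²]`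
(`D > 0`, i.e. `W < 0`); with `′ = d/dx = (1 − 2M/r) d/dr` and `𝒟g := g − w g_w = 1 + Σ_{n≥2}(1−n)G_n wⁿ`:
`D′ = (1−2w)·𝒟g`, `|𝒟g − 1| ≤ w t/(1−t)² ≤ 1.011 w t`, hence `1/2 ≤ D′ ≤ 1` and `1 − D′ ≤ 2.01 w ≤ 1/64`
— these are the four inequalities, since `U = W′ + W² = (1 + D′)/D²` (`D′ ≤ 1 ⟺ U ≤ 2W²`, `D′ ≥ 1/2 ⟺
W² ≤ 2(U − W²)`, `64(1 − D′) ≤ 1 ⟺ 64(2W² − U) ≤ W²`); and `D″ = (1−2w)(w²/M)[2𝒟g + (1−2w)·Σ n(n−1)G_n wⁿ/w·w]`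
with `|Σ n(n−1) G_n wⁿ| ≤ 2.03 w t`, so `D″ > 0` and `(2W² − U)′ = ((1 − D′)/D²)′ = −(D″D + 2(1−D′)D′)/D³ ≤ 0`,
which is `4W(U − W²) − U′ ≤ 0` (`U′ = W″ + 2WW′` from `U = W′ + W²` on the open set).  Series calculus as in
`stub_seriesChain` (term-wise first and second derivatives of `Σ G n wⁿ`, `|w| < 1/(2R)`).  Leans on:
Mathlib, `ReggeWheeler.IsTortoiseRadius.{hasDerivAt, pos, two_mul_lt}`. -/
theorem stub_shiftFromCoeffs :
    ∀ (M R : ℝ) (r : ℝ → ℝ) (xc : ℝ), IsTortoiseRadius M r xc → 1 ≤ R →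
      ∀ (G Ω : ℕ → ℝ), G 0 = 1 → Ω 0 = 1 → |G 1| ≤ R → (∀ n, 2 ≤ n → |G n| ≤ R ^ (n - 1)) →
      (∀ n, |Ω n| ≤ R ^ n) →
      (∀ n, ∑ i ∈ Finset.range (n + 1), G i * Ω (n - i) = if n = 0 then 1 else 0) →
      ∀ (W U : ℝ → ℝ) (X : ℝ), (∀ x, X < x → 200 * R * M ≤ r x) →
        (∀ x, X < x → W x = -(1 / r x) * ∑' n, Ω n * (M / r x) ^ n) →
        (∀ x, X < x → HasDerivAt W (U x - W x ^ 2) x) →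
        ∀ x, X < x →
          W x < 0 ∧ U x ≤ 2 * W x ^ 2 ∧
          W x ^ 2 ≤ 2 * (U x - W x ^ 2) ∧ 64 * (2 * W x ^ 2 - U x) ≤ W x ^ 2 ∧
          ∃ u' : ℝ, HasDerivAt U u' x ∧ 4 * W x * (U x - W x ^ 2) - u' ≤ 0 := by
  sorry

/-- **R_D reassembled (PROVED): the registered v3 signature of `stub_shiftBounds` from the five stubs
above** — `ρ₃ = 600KM + 1`, `C₃ = 600KM` (`K` from `stub_coeffMajorant`): beyond `xc + ρ − 1` the area
radius exceeds `200RM` (`r ≥ 3M + (x − xc)/3`), the coefficient arrays exist (F) and are bounded (A), the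
analytic germs solve the chain there (C₁) and coincide with the hypothesised ladder (C₂), and the last
rung's germ delivers the clauses (B) with `a′ = max a (xc + ρ − 1)`. -/
theorem stub_shiftBounds :
    ∀ M : ℝ, 0 < M → ∃ ρ₃ : ℝ, 0 ≤ ρ₃ ∧ ∃ C₃ : ℝ, 0 ≤ C₃ ∧
      ∀ (r : ℝ → ℝ) (xc : ℝ), IsTortoiseRadius M r xc → ∀ (s ℓ : ℕ), s ≤ 2 → s ≤ ℓ → 1 ≤ ℓ →
        ∀ ρ : ℝ, ρ₃ + C₃ * Real.log ((ℓ : ℝ) + 1) ≤ ρ →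
          ∀ (W U : ℕ → ℝ → ℝ) (a : ℝ), a < xc + ρ →
            (∀ x, a < x → U 0 x = linePotential M s ℓ r x) →
            (∀ k, k < ℓ → ∀ x, a < x → HasDerivAt (W k) (U k x - W k x ^ 2) x) →
            (∀ k, k < ℓ → ∀ x, a < x → U (k + 1) x = 2 * W k x ^ 2 - U k x) →
            (∀ k, k < ℓ → Tendsto (fun x => x * W k x) atTop (𝓝 ((k : ℝ) - ℓ))) →
            ∃ a' : ℝ, a ≤ a' ∧ a' < xc + ρ ∧
              (∀ x, a' < x → W (ℓ - 1) x < 0 ∧ U (ℓ - 1) x ≤ 2 * W (ℓ - 1) x ^ 2) ∧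
              (∀ x, xc + ρ ≤ x →
                W (ℓ - 1) x ^ 2 ≤ 2 * (U (ℓ - 1) x - W (ℓ - 1) x ^ 2) ∧
                64 * (2 * W (ℓ - 1) x ^ 2 - U (ℓ - 1) x) ≤ W (ℓ - 1) x ^ 2) ∧
              (∀ x, xc + ρ ≤ x → ∃ u' : ℝ, HasDerivAt (U (ℓ - 1)) u' x ∧
                4 * W (ℓ - 1) x * (U (ℓ - 1) x - W (ℓ - 1) x ^ 2) - u' ≤ 0) := by
  intro M hM
  obtain ⟨K, hK1, HA⟩ := stub_coeffMajorant
  have hK0 : 0 ≤ K := zero_le_one.trans hK1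
  refine ⟨600 * K * M + 1, by positivity, 600 * K * M, by positivity, ?_⟩
  intro r xc hr s ℓ hs hsℓ hℓ ρ hρ W U a ha hL0 hL1 hL2 hL3
  -- the log factor and the radius `R`
  set Lg : ℝ := 1 + Real.log ((ℓ : ℝ) + 1) with hLg
  have hlog : 0 ≤ Real.log ((ℓ : ℝ) + 1) :=
    Real.log_nonneg (by have : (0 : ℝ) ≤ ℓ := Nat.cast_nonneg ℓ; linarith)
  have hLg1 : 1 ≤ Lg := by rw [hLg]; linarith
  set R : ℝ := K * Lg with hRdef
  have hR1 : 1 ≤ R := by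
    rw [hRdef]; nlinarith
  have hR0 : 0 ≤ R := zero_le_one.trans hR1
  -- the coefficient arrays and their bounds
  obtain ⟨Ω, G, hΩ0, hG0, hinv, hR0eq, hRKeq⟩ := stub_coeffExists s ℓ hℓ
  have HB := HA s ℓ hs hsℓ hℓ Ω G hΩ0 hG0 hinv hR0eq hRKeq
  have hΩbd : ∀ k, k + 1 ≤ ℓ → ∀ n, |Ω k n| ≤ R ^ n := fun k hk n => (HB k hk).2.2 n
  -- the threshold point `X = max a (xc + ρ − 1)` and the area radius beyond it
  have hρ1 : 600 * K * M * Lg + 1 ≤ ρ := by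
    have : (600 * K * M + 1) + 600 * K * M * Real.log ((ℓ : ℝ) + 1) = 600 * K * M * Lg + 1 := by
      rw [hLg]; ring
    linarith
  set X : ℝ := max a (xc + ρ - 1) with hXdef
  have hXa : a ≤ X := le_max_left _ _
  have hXρ : X < xc + ρ := max_lt ha (by linarith)
  have hrX : ∀ x, X < x → 200 * R * M < r x := by
    intro x hx
    have hx1 : xc + ρ - 1 < x := lt_of_le_of_lt (le_max_right _ _) hx
    have hKM : 0 ≤ 600 * K * M * Lg := by positivity
    have hxc : xc ≤ x := by linarith
    have h3 := tortoise_ge_third hr.mass_pos hr.two_mul_lt hr.hasDerivAt hr.center hxc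
    have : 200 * R * M = (600 * K * M * Lg) / 3 := by rw [hRdef]; ring
    rw [this]
    have hM3 : 0 < 3 * M := by linarith [hr.mass_pos]
    linarith
  have hrX' : ∀ x, X < x → 2 * R * M < r x := fun x hx => by
    have := hrX x hx
    have : 0 ≤ R * M := mul_nonneg hR0 hM.le
    linarith
  have haX : ∀ x, X < x → a < x := fun x hx => lt_of_le_of_lt hXa hx
  -- the analytic germs
  set Wa : ℕ → ℝ → ℝ := fun k x => -(((ℓ : ℝ) - k) / r x) * ∑' n, Ω k n * (M / r x) ^ n with hWadef
  have hWa : ∀ k x, Wa k x = -(((ℓ : ℝ) - k) / r x) * ∑' n, Ω k n * (M / r x) ^ n := fun k x => rfl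
  obtain ⟨Ua, hUa0, hUas⟩ : ∃ Ua : ℕ → ℝ → ℝ, (∀ x, Ua 0 x = linePotential M s ℓ r x) ∧
      (∀ k x, Ua (k + 1) x = 2 * Wa k x ^ 2 - Ua k x) :=
    ⟨fun k => Nat.rec (linePotential M s ℓ r) (fun j Uj => fun x => 2 * Wa j x ^ 2 - Uj x) k,
      fun x => rfl, fun k x => rfl⟩
  obtain ⟨hder, hlim⟩ :=
    stub_seriesChain M r xc hr s ℓ Ω R hR1 hΩ0 hΩbd hR0eq hRKeq Wa Ua hWa hUa0 hUas
  -- identification of the hypothesised ladder with the germs on `(X, ∞)`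
  have hid : ∀ k, k < ℓ → ∀ x, X < x → W k x = Wa k x ∧ U k x = Ua k x :=
    stub_recessiveUnique ℓ (linePotential M s ℓ r) W U Wa Ua X
      (fun x hx => hL0 x (haX x hx)) (fun x _ => hUa0 x)
      (fun k hk x hx => hL1 k hk x (haX x hx))
      (fun k hk x hx => hder k (by omega) x (hrX' x hx))
      (fun k hk x hx => hL2 k hk x (haX x hx)) (fun k _ x _ => hUas k x)
      hL3 (fun k hk => hlim k (by omega))
  -- the last rung
  have hℓ1 : ℓ - 1 < ℓ := by omega
  have hℓ1' : ℓ - 1 + 1 ≤ ℓ := by omega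
  have hcast : ((ℓ : ℝ) - ((ℓ - 1 : ℕ) : ℝ)) = 1 := by
    rw [Nat.cast_sub hℓ]; push_cast; ring
  obtain ⟨hG1, hGn, hΩn⟩ := HB (ℓ - 1) hℓ1'
  have hWser : ∀ x, X < x → W (ℓ - 1) x = -(1 / r x) * ∑' n, Ω (ℓ - 1) n * (M / r x) ^ n := by
    intro x hx
    rw [(hid (ℓ - 1) hℓ1 x hx).1, hWa, hcast]
  have HBx := stub_shiftFromCoeffs M R r xc hr hR1 (G (ℓ - 1)) (Ω (ℓ - 1)) (hG0 _) (hΩ0 _) hG1 hGn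
    hΩn (hinv (ℓ - 1)) (W (ℓ - 1)) (U (ℓ - 1)) X (fun x hx => (hrX x hx).le) hWser
    (fun x hx => hL1 (ℓ - 1) hℓ1 x (haX x hx))
  refine ⟨X, hXa, hXρ, fun x hx => ⟨(HBx x hx).1, (HBx x hx).2.1⟩, fun x hx => ?_, fun x hx => ?_⟩
  · have hx' : X < x := lt_of_lt_of_le hXρ hx
    exact ⟨(HBx x hx').2.2.1, (HBx x hx').2.2.2.1⟩
  · have hx' : X < x := lt_of_lt_of_le hXρ hx
    exact (HBx x hx').2.2.2.2

/-- **Stub (R_D ⇒ R) — the residual clauses from the shift bounds (size M).**  Abstract calculus: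
let `ℓ ≥ 1`, `W := W (ℓ−1)` solve `W′ = U(ℓ−1) − W²` on `(a, ∞)` and `U ℓ = 2W² − U(ℓ−1)` there; let
`a ≤ a′ < x_f`.  If `W < 0` and `U(ℓ−1) ≤ 2W²` on `(a′, ∞)`, then `U ℓ ≥ 0` on `(a′, ∞)` (first
clause, witness `a″ = a′`).  If on `[x_f, ∞)` moreover `W² ≤ 2(U(ℓ−1) − W²)` and
`64(2W² − U(ℓ−1)) ≤ W²`, then with `D = −1/W`, `D′ = (U(ℓ−1) − W²)/W² ∈ [1/2, 1]`, `1 − D′ ≤ 1/64`,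
the landed `Literature.Analysis.ODE.sq_mul_crum_next_le` (`κ = 1/2`, `K = 1/64`) gives
`t²·U ℓ (x_f + t) = t²(2W² − U(ℓ−1))(x_f+t) ≤ K/κ² = 1/16` (third clause).  If finally `U(ℓ−1)` is
differentiable on `[x_f, ∞)` with `4W(U(ℓ−1) − W²) − U(ℓ−1)′ ≤ 0`, then `U ℓ = 2W² − U(ℓ−1)` has
derivative `4W·W′ − U(ℓ−1)′ ≤ 0` on `[x_f, ∞)`, hence is antitone there (second clause;
`antitoneOn_of_deriv_nonpos` on the convex set `Ici x_f`, continuity from differentiability).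
Leans on `Literature.Analysis.ODE.{crum_next_eq_shift, crum_next_nonneg, sq_mul_crum_next_le}`
(landed) and Mathlib's monotonicity-from-derivative lemmas. -/
theorem stub_residualFromShift :
    ∀ (W U : ℕ → ℝ → ℝ) (ℓ : ℕ) (a a' xf : ℝ), 1 ≤ ℓ → a ≤ a' → a' < xf →
      (∀ x, a < x → HasDerivAt (W (ℓ - 1)) (U (ℓ - 1) x - W (ℓ - 1) x ^ 2) x) →
      (∀ x, a < x → U ℓ x = 2 * W (ℓ - 1) x ^ 2 - U (ℓ - 1) x) →
      (∀ x, a' < x → W (ℓ - 1) x < 0 ∧ U (ℓ - 1) x ≤ 2 * W (ℓ - 1) x ^ 2) →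
      (∀ x, xf ≤ x →
        W (ℓ - 1) x ^ 2 ≤ 2 * (U (ℓ - 1) x - W (ℓ - 1) x ^ 2) ∧
        64 * (2 * W (ℓ - 1) x ^ 2 - U (ℓ - 1) x) ≤ W (ℓ - 1) x ^ 2) →
      (∀ x, xf ≤ x → ∃ u' : ℝ, HasDerivAt (U (ℓ - 1)) u' x ∧
        4 * W (ℓ - 1) x * (U (ℓ - 1) x - W (ℓ - 1) x ^ 2) - u' ≤ 0) →
      (∃ a'' : ℝ, a ≤ a'' ∧ a'' < xf ∧ ∀ x, a'' < x → 0 ≤ U ℓ x) ∧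
      AntitoneOn (U ℓ) (Set.Ici xf) ∧
      ∀ t : ℝ, 0 < t → t ^ 2 * U ℓ (xf + t) ≤ 1 / 16 :=
  Summit.FinalStateConjecture.FinalStateConjecture.Theorems.CrumPeelingRecessiveTower.stub_residualFromShift

/-- **R reassembled (PROVED): the registered v2 signature of `stub_residualSubHardy` from R₀, R_D and
(R_D ⇒ R)** — `ρ₂ = max ρ₃ ρ₄`, `C₂ = C₃`; for `ℓ = 0` (forcing `s = 0`, and `log 1 = 0`) use R₀, for
`ℓ ≥ 1` feed R_D's bounds at `x_f = xc + ρ` into the reduction. -/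
theorem residualSubHardy_of_stubs :
    ∀ M : ℝ, 0 < M → ∃ ρ₂ : ℝ, 0 ≤ ρ₂ ∧ ∃ C₂ : ℝ, 0 ≤ C₂ ∧
      ∀ (r : ℝ → ℝ) (xc : ℝ), IsTortoiseRadius M r xc → ∀ (s ℓ : ℕ), s ≤ 2 → s ≤ ℓ →
        ∀ ρ : ℝ, ρ₂ + C₂ * Real.log ((ℓ : ℝ) + 1) ≤ ρ →
          ∀ (W U : ℕ → ℝ → ℝ) (a : ℝ), a < xc + ρ →
            (∀ x, a < x → U 0 x = linePotential M s ℓ r x) →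
            (∀ k, k < ℓ → ∀ x, a < x → HasDerivAt (W k) (U k x - W k x ^ 2) x) →
            (∀ k, k < ℓ → ∀ x, a < x → U (k + 1) x = 2 * W k x ^ 2 - U k x) →
            (∀ k, k < ℓ → Tendsto (fun x => x * W k x) atTop (𝓝 ((k : ℝ) - ℓ))) →
            (∃ a' : ℝ, a ≤ a' ∧ a' < xc + ρ ∧ ∀ x, a' < x → 0 ≤ U ℓ x) ∧
            AntitoneOn (U ℓ) (Set.Ici (xc + ρ)) ∧
            ∀ t : ℝ, 0 < t → t ^ 2 * U ℓ (xc + ρ + t) ≤ 1 / 16 := by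
  intro M hM
  obtain ⟨ρ₄, hρ₄, HZ⟩ := stub_residualZero M hM
  obtain ⟨ρ₃, hρ₃, C₃, hC₃, HD⟩ := stub_shiftBounds M hM
  refine ⟨max ρ₃ ρ₄, hρ₃.trans (le_max_left _ _), C₃, hC₃, ?_⟩
  intro r xc hr s ℓ hs hsℓ ρ hρ W U a ha hL0 hL1 hL2 hL3
  have hlog : 0 ≤ Real.log ((ℓ : ℝ) + 1) := by
    apply Real.log_nonneg
    have : (0 : ℝ) ≤ ℓ := Nat.cast_nonneg ℓ
    linarith
  rcases Nat.eq_zero_or_pos ℓ with h0 | hpos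
  · -- ℓ = 0: no rung, `s = 0`
    subst h0
    obtain rfl : s = 0 := Nat.le_zero.mp hsℓ
    have hρ4 : ρ₄ ≤ ρ := by
      have h1 : ρ₄ ≤ max ρ₃ ρ₄ := le_max_right _ _
      have h2 : 0 ≤ C₃ * Real.log (((0 : ℕ) : ℝ) + 1) := mul_nonneg hC₃ hlog
      linarith
    exact HZ r xc hr ρ hρ4 U a ha hL0
  · -- ℓ ≥ 1: shift bounds, then the reduction
    have hρ3 : ρ₃ + C₃ * Real.log ((ℓ : ℝ) + 1) ≤ ρ := by
      have h1 : ρ₃ ≤ max ρ₃ ρ₄ := le_max_left _ _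
      linarith
    obtain ⟨a', haa', ha', H12, H3, H4⟩ :=
      HD r xc hr s ℓ hs hsℓ hpos ρ hρ3 W U a ha hL0 hL1 hL2 hL3
    have hW : ∀ x, a < x → HasDerivAt (W (ℓ - 1)) (U (ℓ - 1) x - W (ℓ - 1) x ^ 2) x :=
      hL1 (ℓ - 1) (by omega)
    have hU : ∀ x, a < x → U ℓ x = 2 * W (ℓ - 1) x ^ 2 - U (ℓ - 1) x := by
      intro x hx
      have h := hL2 (ℓ - 1) (by omega) x hx
      rwa [Nat.sub_add_cancel hpos] at h
    exact stub_residualFromShift W U ℓ a a' (xc + ρ) hpos haa' ha' hW hU H12 H3 H4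

/-- **Stub P — peeling: the iterated energy-level Darboux correspondence (size L).**  Given a
recessive ladder `(W, U, a)` of `V = V_{s,ℓ}` with `Q = U ℓ ≥ 0` on `(a, ∞)`, an edge `x_f > a` and
a global Regge–Wheeler solution `ψ` of finite far energy at `t = 0`, there are a `C²` solution `φ`
of `φ_tt − φ_xx + Qφ = 0` on the half-plane `{x > a}` with finite far `Q`-energy (the `ℓ`-fold
image `φ = A_ℓ ∂ₜ⁻¹ ⋯ A₁ ∂ₜ⁻¹ ψ`, `A_k = ∂ₓ − W_{k−1}`, each time primitive normalised by finite
far energy — the normalisation whose omission made the ideator's `OneStepFarDeficitIdentity` false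
as typed, TRIAGE-r1-2, TRIAGE-r1-3) and a finite-energy static solution `u` of `u'' = Qu` on `(a, ∞)` with
`u(x_f) ≠ 0` (the single surviving kernel mode `u_Q ≈ 1 + O(M/x)`) such that
(i) the far channel energies do not increase: `E^±_Q(φ; x_f) ≤ E^±_V(ψ; x_f)` (in truth `=`: the
edge weight `|W_k(x_f+|t|)| · trace² → 0` along the moving edge, from tail energy + Hardy,
TRIAGE-r1-3 sharpen (2)), and (ii) the `V`-deficit of `ψ` over the `t`-polynomial far kernel is at
most the one-mode `Q`-deficit of `φ`: `inf_{p ∈ P_far(V)} E_V(ψ − p)(0) ≤ inf_c E_Q(φ − c u)(0)`.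
Mechanism (all exact, re-derived by the three triagers): with `A = ∂ₓ − W`, `V = W' + W²`,
`V₁ = W² − W'`: `φₓ² + Vφ² = (Aφ)² + (Wφ²)'`; for `θ̃ = A χ`, `χ_t = θ`: `θ̃_t = Aθ`,
`A*θ̃ = −θ_t`, hence `∫ θ̃_t² + (A*θ̃)² = ∫ (Aθ)² + θ_t²` POINTWISE — the rung is an isometry
`F_k(θ) = G_{k+1}(θ̃)` with no edge term, `F_k` kills the seed, the seed's edge term
`|W(x_f)|·tr²` is zeroed by the next tower element; the towers (finite-energy `t`-polynomial
solutions, `⌊(2ℓ+5)/4⌋ + ⌊(2ℓ+3)/4⌋ = ℓ+1` of them) map to towers and lie in `P_far(V)`, so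
`inf_{P_far}` ≤ `dist²(ψ, towers) = F_ℓ(φ) = inf_c E_Q(φ − c u_Q)`.  Regularity: `χ_t = θ ∈ C²`
and `χ_xx = χ_tt + Vχ` make `χ ∈ C³`, so each rung preserves `C²` (no loss).  Flat check `ℓ = 1`:
`u₀ = 1/x ↦ 0`, `t·u₀ ↦ A(−x/2) = −1 = u_Q` ✓.  Leans on `Literature.Analysis.PDE.wave1D_intertwine`
(template, `ι' = −ι²` ↦ `W' + W² = V`), `InverseSquareLadder*`, `RecessiveSolution`,
`Wave1D{FluxBookkeeping,FarEnergyLimits,TrapezoidEnergy}`.  `ℓ = 0`: `φ = ψ`, `u` = the bounded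
static solution of `V_{0,0}`. -/
theorem stub_peel :
    ∀ (M : ℝ) (r : ℝ → ℝ) (xc : ℝ), IsTortoiseRadius M r xc → ∀ (s ℓ : ℕ), s ≤ 2 → s ≤ ℓ →
      ∀ (W U : ℕ → ℝ → ℝ) (a : ℝ),
        (∀ x, a < x → U 0 x = linePotential M s ℓ r x) →
        (∀ k, k < ℓ → ∀ x, a < x → HasDerivAt (W k) (U k x - W k x ^ 2) x) →
        (∀ k, k < ℓ → ∀ x, a < x → U (k + 1) x = 2 * W k x ^ 2 - U k x) →
        (∀ k, k < ℓ → Tendsto (fun x => x * W k x) atTop (𝓝 ((k : ℝ) - ℓ))) →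
        (∀ x, a < x → 0 ≤ U ℓ x) →
        ∀ xf : ℝ, a < xf → ∀ ψ : ℝ → ℝ → ℝ, IsRWSolution M s ℓ r ψ →
          farEnergy (linePotential M s ℓ r) xf ψ 0 ≠ ⊤ →
          ∃ (φ : ℝ → ℝ → ℝ) (u : ℝ → ℝ),
            ContDiffOn ℝ 2 (Function.uncurry φ) {z : ℝ × ℝ | a < z.2} ∧
            (∀ z : ℝ × ℝ, a < z.2 → IsSolutionAt (U ℓ) φ z) ∧
            farEnergy (U ℓ) xf φ 0 ≠ ⊤ ∧
            ContDiffOn ℝ 2 u (Set.Ioi a) ∧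
            (∀ x, a < x → iteratedDeriv 2 u x = U ℓ x * u x) ∧
            (∫⁻ x in Set.Ioi xf, ENNReal.ofReal (deriv u x ^ 2 + U ℓ x * u x ^ 2)) ≠ ⊤ ∧
            u xf ≠ 0 ∧
            farChannelEnergy (U ℓ) xf φ atTop ≤ farChannelEnergy (linePotential M s ℓ r) xf ψ atTop ∧
            farChannelEnergy (U ℓ) xf φ atBot ≤ farChannelEnergy (linePotential M s ℓ r) xf ψ atBot ∧
            (⨅ p ∈ {p : ℝ → ℝ → ℝ |
                IsSolutionOn (linePotential M s ℓ r) p {z : ℝ × ℝ | xf + |z.1| < z.2} ∧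
                  IsPolynomialInTimeOn p {z : ℝ × ℝ | xf + |z.1| < z.2}},
              ∫⁻ x in Set.Ioi xf, ENNReal.ofReal
                (energyDensity (linePotential M s ℓ r) (fun t y => ψ t y - p t y) 0 x))
              ≤ ⨅ c : ℝ, ∫⁻ x in Set.Ioi xf, ENNReal.ofReal
                (energyDensity (U ℓ) (fun t y => φ t y - c * u y) 0 x) :=
  Summit.FinalStateConjecture.FinalStateConjecture.Theorems.CrumPeelingRecessiveTower.stub_peel

/-- **Stub K′ — kernel-one far channels for a sub-Hardy potential: wedge identity + Hardy on the
null rays (LANDED as `Theorems.CrumPeelingRecessiveTower.stub_kernelOneChannelsNoMoment`; the v1 stub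
`stub_kernelOneChannels`, landed too, carried an unused short-range hypothesis).**  Let `Q ∈ C¹(a, ∞)`,
`Q ≥ 0`, non-increasing on `[x_f, ∞)` (`a < x_f`), with Hardy size `t² Q(x_f + t) ≤ 1/16`; let `u` be a finite-energy static solution (`u'' = Qu`) on `(a, ∞)`
with `u(x_f) ≠ 0`, and `φ` a `C²` solution of `φ_tt − φ_xx + Qφ = 0` on the half-plane `{x > a}`
with finite far energy at `t = 0`.  Then
`(1/2) · inf_c E_Q[φ − c u; x > x_f](0) ≤ E⁺_far + E⁻_far`.
Proof sketch (re-derived by all three triagers; TRIAGE-r1-2 E4 checks the identity to `1e-10` on a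
radiating exact solution): subtract `c₀ u`, `c₀ = φ(0,x_f)/u(x_f)` (changes no channel energy: a
finite-energy static mode radiates nothing); WEDGE IDENTITY
`E⁺ + E⁻ + ∫_{C⁺∪C⁻} Qφ² dt = E_far(0) + ½∬_{far cone} (−Q')ψ² ≥ E_far(0)` (flux
`dE_far/dt = −(φ̇² + Qφ²)` on the rays `C^± = {(t, x_f ± t)}` plus the sideways identity for
`X ↦ ∫_{|t|<X−x_f} (ψ_x² + ψ_t² − Qψ²)(t, X) dt → E⁺ + E⁻`); HARDY on each ray with corner value
`0`: `∫_{C^±} Qφ² ≤ 4K ∫_{C^±} φ̇² ≤ 4K · LOST^±`, `K = 1/16`, `LOST⁺ + LOST⁻ = 2E_far(0) − E⁺ − E⁻`;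
hence `(1 − 4K)(E⁺ + E⁻) ≥ (1 − 8K) E_far(0)`, i.e. `E⁺ + E⁻ ≥ (2/3) E_far(φ − c₀u)(0) ≥ (1/2) inf_c`.
The only non-algebraic step is the limit exchange `Ẽ(X) → E⁺ + E⁻` (far radiation field in energy
norm; `∫_{|t|<X} Q(X)ψ(t,X)² dt → 0`), classical for short-range `Q` (first moment finite) — hence
that hypothesis (TRIAGE-r1-1 sharpen).  Infinite-energy `φ` are excluded by hypothesis (handled in
the composition by `wave1D_farEnergy_eq_top_of_initial_eq_top`).  Flat check `Q ≡ 0`: free waves,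
`E⁺ + E⁻ = E_far(0)` exactly, `u = const`. -/
theorem stub_kernelOneChannelsNoMoment :
    ∀ (Q : ℝ → ℝ) (a xf : ℝ), a < xf → ContDiffOn ℝ 1 Q (Set.Ioi a) → (∀ x, a < x → 0 ≤ Q x) →
      AntitoneOn Q (Set.Ici xf) →
      (∀ t : ℝ, 0 < t → t ^ 2 * Q (xf + t) ≤ 1 / 16) →
      ∀ u : ℝ → ℝ, ContDiffOn ℝ 2 u (Set.Ioi a) →
        (∀ x, a < x → iteratedDeriv 2 u x = Q x * u x) →
        (∫⁻ x in Set.Ioi xf, ENNReal.ofReal (deriv u x ^ 2 + Q x * u x ^ 2)) ≠ ⊤ → u xf ≠ 0 →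
        ∀ φ : ℝ → ℝ → ℝ, ContDiffOn ℝ 2 (Function.uncurry φ) {z : ℝ × ℝ | a < z.2} →
          (∀ z : ℝ × ℝ, a < z.2 → IsSolutionAt Q φ z) → farEnergy Q xf φ 0 ≠ ⊤ →
          ENNReal.ofReal (1 / 2) *
              (⨅ c : ℝ, ∫⁻ x in Set.Ioi xf,
                ENNReal.ofReal (energyDensity Q (fun t y => φ t y - c * u y) 0 x))
            ≤ farChannelEnergy Q xf φ atTop + farChannelEnergy Q xf φ atBot :=
  Summit.FinalStateConjecture.FinalStateConjecture.Theorems.CrumPeelingRecessiveTower.stub_kernelOneChannelsNoMoment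

/-! ## §2 The stub statements and the two halves of K1R as named `Prop`s (internal
abbreviations, each DEFINITIONALLY equal to the corresponding inline stub statement above; provers
never import this file — every stub is self-contained over existing declarations) -/

/-- Statement of `stub_nearLogEdgeChannels` (the NEAR log-edge half of K1R). -/
def NearLogEdgeChannels : Prop :=
  ∀ M : ℝ, 0 < M → ∃ ρ₀ : ℝ, 0 ≤ ρ₀ ∧ ∃ C : ℝ, 0 ≤ C ∧ ∃ c : ℝ, 0 < c ∧
    ∀ (r : ℝ → ℝ) (xc : ℝ), IsTortoiseRadius M r xc → ∀ (s ℓ : ℕ), s ≤ 2 → s ≤ ℓ →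
      ∀ ρ : ℝ, ρ₀ + C * Real.log ((ℓ : ℝ) + 1) ≤ ρ →
        ∀ ψ : ℝ → ℝ → ℝ, IsRWSolution M s ℓ r ψ →
          ENNReal.ofReal c *
              (⨅ p ∈ {p : ℝ → ℝ → ℝ |
                  IsSolutionOn (linePotential M s ℓ r) p {z : ℝ × ℝ | z.2 < xc - ρ - |z.1|} ∧
                    IsPolynomialInTimeOn p {z : ℝ × ℝ | z.2 < xc - ρ - |z.1|}},
                ∫⁻ x in Set.Iio (xc - ρ), ENNReal.ofReal
                  (energyDensity (linePotential M s ℓ r) (fun t y => ψ t y - p t y) 0 x))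
            ≤ liminf (fun t => ∫⁻ x in Set.Iio (xc - ρ - |t|),
                  ENNReal.ofReal (energyDensity (linePotential M s ℓ r) ψ t x)) atTop
              + liminf (fun t => ∫⁻ x in Set.Iio (xc - ρ - |t|),
                  ENNReal.ofReal (energyDensity (linePotential M s ℓ r) ψ t x)) atBot

/-- Statement of `stub_ladderExists`. -/
def LadderExists : Prop :=
  ∀ M : ℝ, 0 < M → ∃ ρ₁ : ℝ, 0 ≤ ρ₁ ∧ ∃ C₁ : ℝ, 0 ≤ C₁ ∧
    ∀ (r : ℝ → ℝ) (xc : ℝ), IsTortoiseRadius M r xc → ∀ (s ℓ : ℕ), s ≤ 2 → s ≤ ℓ →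
      ∀ ρ : ℝ, ρ₁ + C₁ * Real.log ((ℓ : ℝ) + 1) ≤ ρ →
        ∃ (W U : ℕ → ℝ → ℝ) (a : ℝ), a < xc + ρ ∧
          (∀ x, a < x → U 0 x = linePotential M s ℓ r x) ∧
          (∀ k, k < ℓ → ∀ x, a < x → HasDerivAt (W k) (U k x - W k x ^ 2) x) ∧
          (∀ k, k < ℓ → ∀ x, a < x → U (k + 1) x = 2 * W k x ^ 2 - U k x) ∧
          (∀ k, k < ℓ → Tendsto (fun x => x * W k x) atTop (𝓝 ((k : ℝ) - ℓ))) ∧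
          ContDiffOn ℝ 1 (U ℓ) (Set.Ioi a)

/-- Statement of `stub_residualSubHardy`. -/
def ResidualSubHardy : Prop :=
  ∀ M : ℝ, 0 < M → ∃ ρ₂ : ℝ, 0 ≤ ρ₂ ∧ ∃ C₂ : ℝ, 0 ≤ C₂ ∧
    ∀ (r : ℝ → ℝ) (xc : ℝ), IsTortoiseRadius M r xc → ∀ (s ℓ : ℕ), s ≤ 2 → s ≤ ℓ →
      ∀ ρ : ℝ, ρ₂ + C₂ * Real.log ((ℓ : ℝ) + 1) ≤ ρ →
        ∀ (W U : ℕ → ℝ → ℝ) (a : ℝ), a < xc + ρ →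
          (∀ x, a < x → U 0 x = linePotential M s ℓ r x) →
          (∀ k, k < ℓ → ∀ x, a < x → HasDerivAt (W k) (U k x - W k x ^ 2) x) →
          (∀ k, k < ℓ → ∀ x, a < x → U (k + 1) x = 2 * W k x ^ 2 - U k x) →
          (∀ k, k < ℓ → Tendsto (fun x => x * W k x) atTop (𝓝 ((k : ℝ) - ℓ))) →
          (∃ a' : ℝ, a ≤ a' ∧ a' < xc + ρ ∧ ∀ x, a' < x → 0 ≤ U ℓ x) ∧
          AntitoneOn (U ℓ) (Set.Ici (xc + ρ)) ∧
          ∀ t : ℝ, 0 < t → t ^ 2 * U ℓ (xc + ρ + t) ≤ 1 / 16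

/-- Statement of `stub_peel`. -/
def Peel : Prop :=
  ∀ (M : ℝ) (r : ℝ → ℝ) (xc : ℝ), IsTortoiseRadius M r xc → ∀ (s ℓ : ℕ), s ≤ 2 → s ≤ ℓ →
    ∀ (W U : ℕ → ℝ → ℝ) (a : ℝ),
      (∀ x, a < x → U 0 x = linePotential M s ℓ r x) →
      (∀ k, k < ℓ → ∀ x, a < x → HasDerivAt (W k) (U k x - W k x ^ 2) x) →
      (∀ k, k < ℓ → ∀ x, a < x → U (k + 1) x = 2 * W k x ^ 2 - U k x) →
      (∀ k, k < ℓ → Tendsto (fun x => x * W k x) atTop (𝓝 ((k : ℝ) - ℓ))) →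
      (∀ x, a < x → 0 ≤ U ℓ x) →
      ∀ xf : ℝ, a < xf → ∀ ψ : ℝ → ℝ → ℝ, IsRWSolution M s ℓ r ψ →
        farEnergy (linePotential M s ℓ r) xf ψ 0 ≠ ⊤ →
        ∃ (φ : ℝ → ℝ → ℝ) (u : ℝ → ℝ),
          ContDiffOn ℝ 2 (Function.uncurry φ) {z : ℝ × ℝ | a < z.2} ∧
          (∀ z : ℝ × ℝ, a < z.2 → IsSolutionAt (U ℓ) φ z) ∧
          farEnergy (U ℓ) xf φ 0 ≠ ⊤ ∧
          ContDiffOn ℝ 2 u (Set.Ioi a) ∧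
          (∀ x, a < x → iteratedDeriv 2 u x = U ℓ x * u x) ∧
          (∫⁻ x in Set.Ioi xf, ENNReal.ofReal (deriv u x ^ 2 + U ℓ x * u x ^ 2)) ≠ ⊤ ∧
          u xf ≠ 0 ∧
          farChannelEnergy (U ℓ) xf φ atTop ≤ farChannelEnergy (linePotential M s ℓ r) xf ψ atTop ∧
          farChannelEnergy (U ℓ) xf φ atBot ≤ farChannelEnergy (linePotential M s ℓ r) xf ψ atBot ∧
          (⨅ p ∈ {p : ℝ → ℝ → ℝ |
              IsSolutionOn (linePotential M s ℓ r) p {z : ℝ × ℝ | xf + |z.1| < z.2} ∧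
                IsPolynomialInTimeOn p {z : ℝ × ℝ | xf + |z.1| < z.2}},
            ∫⁻ x in Set.Ioi xf, ENNReal.ofReal
              (energyDensity (linePotential M s ℓ r) (fun t y => ψ t y - p t y) 0 x))
            ≤ ⨅ c : ℝ, ∫⁻ x in Set.Ioi xf, ENNReal.ofReal
              (energyDensity (U ℓ) (fun t y => φ t y - c * u y) 0 x)

/-- Statement of `stub_kernelOneChannelsNoMoment`. -/
def KernelOneChannels : Prop :=
  ∀ (Q : ℝ → ℝ) (a xf : ℝ), a < xf → ContDiffOn ℝ 1 Q (Set.Ioi a) → (∀ x, a < x → 0 ≤ Q x) →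
    AntitoneOn Q (Set.Ici xf) →
    (∀ t : ℝ, 0 < t → t ^ 2 * Q (xf + t) ≤ 1 / 16) →
    ∀ u : ℝ → ℝ, ContDiffOn ℝ 2 u (Set.Ioi a) →
      (∀ x, a < x → iteratedDeriv 2 u x = Q x * u x) →
      (∫⁻ x in Set.Ioi xf, ENNReal.ofReal (deriv u x ^ 2 + Q x * u x ^ 2)) ≠ ⊤ → u xf ≠ 0 →
      ∀ φ : ℝ → ℝ → ℝ, ContDiffOn ℝ 2 (Function.uncurry φ) {z : ℝ × ℝ | a < z.2} →
        (∀ z : ℝ × ℝ, a < z.2 → IsSolutionAt Q φ z) → farEnergy Q xf φ 0 ≠ ⊤ →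
        ENNReal.ofReal (1 / 2) *
            (⨅ c : ℝ, ∫⁻ x in Set.Ioi xf,
              ENNReal.ofReal (energyDensity Q (fun t y => φ t y - c * u y) 0 x))
          ≤ farChannelEnergy Q xf φ atTop + farChannelEnergy Q xf φ atBot

/-- The FAR log-edge half (the open content of K1R): one-ended far cone with edge `xc + ρ`,
kernel = `t`-polynomial `C²` solutions on the far cone, constant uniform on the log-ball. -/
def FarLogEdgeChannels : Prop :=
  ∀ M : ℝ, 0 < M → ∃ ρ₀ : ℝ, 0 ≤ ρ₀ ∧ ∃ C : ℝ, 0 ≤ C ∧ ∃ c : ℝ, 0 < c ∧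
    ∀ (r : ℝ → ℝ) (xc : ℝ), IsTortoiseRadius M r xc → ∀ (s ℓ : ℕ), s ≤ 2 → s ≤ ℓ →
      ∀ ρ : ℝ, ρ₀ + C * Real.log ((ℓ : ℝ) + 1) ≤ ρ →
        ∀ ψ : ℝ → ℝ → ℝ, IsRWSolution M s ℓ r ψ →
          ENNReal.ofReal c *
              (⨅ p ∈ {p : ℝ → ℝ → ℝ |
                  IsSolutionOn (linePotential M s ℓ r) p {z : ℝ × ℝ | xc + ρ + |z.1| < z.2} ∧
                    IsPolynomialInTimeOn p {z : ℝ × ℝ | xc + ρ + |z.1| < z.2}},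
                ∫⁻ x in Set.Ioi (xc + ρ), ENNReal.ofReal
                  (energyDensity (linePotential M s ℓ r) (fun t y => ψ t y - p t y) 0 x))
            ≤ farChannelEnergy (linePotential M s ℓ r) (xc + ρ) ψ atTop
              + farChannelEnergy (linePotential M s ℓ r) (xc + ρ) ψ atBot

/-! ## §3 PROVED: the far stubs compose to the far half -/

/-- Nonnegativity of `log(ℓ+1)`. -/
theorem log_succ_nonneg (ℓ : ℕ) : 0 ≤ Real.log ((ℓ : ℝ) + 1) := by
  apply Real.log_nonneg
  have : (0 : ℝ) ≤ ℓ := Nat.cast_nonneg ℓ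
  linarith

/-- A threshold `ρ₀ + C log(ℓ+1) ≤ ρ` survives shrinking `ρ₀` and `C`. -/
theorem threshold_mono {ρ₀ ρ₀' C C' ρ : ℝ} {ℓ : ℕ} (hρ : ρ₀ ≤ ρ₀') (hC : C ≤ C')
    (h : ρ₀' + C' * Real.log ((ℓ : ℝ) + 1) ≤ ρ) : ρ₀ + C * Real.log ((ℓ : ℝ) + 1) ≤ ρ := by
  have := mul_le_mul_of_nonneg_right hC (log_succ_nonneg ℓ)
  linarith

/-- **The four far stubs imply the uniform far half** (`ρ₀ = max ρ₁ ρ₂`, `C = max C₁ C₂`,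
`c = 1/2`): take the ladder (E), its sub-Hardy residual (R), peel (P), close (K); infinite far
energy is trivial (it persists at all times, `wave1D_farEnergy_eq_top_of_initial_eq_top`). -/
theorem farLogEdgeChannels_of (hE : LadderExists) (hR : ResidualSubHardy) (hP : Peel)
    (hK : KernelOneChannels) :
    FarLogEdgeChannels := by
  intro M hM
  obtain ⟨ρ₁, hρ₁, C₁, hC₁, HE⟩ := hE M hM
  obtain ⟨ρ₂, hρ₂, C₂, hC₂, HR⟩ := hR M hM
  refine ⟨max ρ₁ ρ₂, hρ₁.trans (le_max_left _ _), max C₁ C₂, hC₁.trans (le_max_left _ _),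
    1 / 2, by norm_num, ?_⟩
  intro r xc hr s ℓ hs hsℓ ρ hρ ψ hψ
  have hρE : ρ₁ + C₁ * Real.log ((ℓ : ℝ) + 1) ≤ ρ :=
    threshold_mono (le_max_left _ _) (le_max_left _ _) hρ
  have hρR : ρ₂ + C₂ * Real.log ((ℓ : ℝ) + 1) ≤ ρ :=
    threshold_mono (le_max_right _ _) (le_max_right _ _) hρ
  set V : ℝ → ℝ := linePotential M s ℓ r with hVdef
  set xf : ℝ := xc + ρ with hxf
  -- the potential
  have hVc : Continuous V := continuous_linePotential s ℓ hr.continuous fun x => (hr.pos x).ne'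
  have hV0 : ∀ x, 0 ≤ V x := linePotential_nonneg hr.mass_pos.le hsℓ hr.two_mul_lt
  have hψ2 : ContDiff ℝ 2 (Function.uncurry ψ) := hψ.1
  have hsol : ∀ t x, iteratedDeriv 2 (fun τ => ψ τ x) t - iteratedDeriv 2 (ψ t) x
      + V x * ψ t x = 0 := fun t x => hψ.2 (t, x)
  by_cases htop : farEnergy V xf ψ 0 = ⊤
  · -- infinite far energy persists: the right-hand side is `⊤`
    have htop' : (∫⁻ x in Set.Ioi xf, ENNReal.ofReal
        (deriv (fun τ => ψ τ x) 0 ^ 2 + deriv (ψ 0) x ^ 2 + V x * ψ 0 x ^ 2)) = ⊤ := by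
      have h := htop
      change (∫⁻ x in Set.Ioi (xf + |(0 : ℝ)|), ENNReal.ofReal
        (deriv (fun τ => ψ τ x) 0 ^ 2 + deriv (ψ 0) x ^ 2 + V x * ψ 0 x ^ 2)) = ⊤ at h
      rwa [abs_zero, add_zero] at h
    have hall : ∀ t, farEnergy V xf ψ t = ⊤ := fun t =>
      wave1D_farEnergy_eq_top_of_initial_eq_top hVc hV0 hψ2 hsol htop' t
    have hfun : farEnergy V xf ψ = fun _ => ⊤ := funext hall
    have h1 : farChannelEnergy V xf ψ atTop = ⊤ := by
      unfold farChannelEnergy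
      rw [hfun, liminf_const]
    rw [h1, top_add]
    exact le_top
  · -- finite far energy: ladder, residual bound, peel, close
    obtain ⟨W, U, a, ha, hL0, hL1, hL2, hL3, hQC1⟩ := HE r xc hr s ℓ hs hsℓ ρ hρE
    obtain ⟨⟨a', haa', ha', hQpos⟩, hanti, hsub⟩ :=
      HR r xc hr s ℓ hs hsℓ ρ hρR W U a ha hL0 hL1 hL2 hL3
    -- restrict the ladder to `(a', ∞)`
    have hL0' : ∀ x, a' < x → U 0 x = V x := fun x hx => hL0 x (lt_of_le_of_lt haa' hx)
    have hL1' : ∀ k, k < ℓ → ∀ x, a' < x → HasDerivAt (W k) (U k x - W k x ^ 2) x :=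
      fun k hk x hx => hL1 k hk x (lt_of_le_of_lt haa' hx)
    have hL2' : ∀ k, k < ℓ → ∀ x, a' < x → U (k + 1) x = 2 * W k x ^ 2 - U k x :=
      fun k hk x hx => hL2 k hk x (lt_of_le_of_lt haa' hx)
    have hQC1' : ContDiffOn ℝ 1 (U ℓ) (Set.Ioi a') := hQC1.mono (Set.Ioi_subset_Ioi haa')
    obtain ⟨φ, u, hφC2, hφsol, hφE, huC2, hueq, huE, hu0, hTop, hBot, hdef⟩ :=
      hP M r xc hr s ℓ hs hsℓ W U a' hL0' hL1' hL2' hL3 hQpos xf ha' ψ hψ htop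
    have hclose := hK (U ℓ) a' xf ha' hQC1' hQpos hanti hsub u huC2 hueq huE hu0 φ hφC2
      hφsol hφE
    calc ENNReal.ofReal (1 / 2) *
          (⨅ p ∈ {p : ℝ → ℝ → ℝ |
              IsSolutionOn V p {z : ℝ × ℝ | xf + |z.1| < z.2} ∧
                IsPolynomialInTimeOn p {z : ℝ × ℝ | xf + |z.1| < z.2}},
            ∫⁻ x in Set.Ioi xf, ENNReal.ofReal (energyDensity V (fun t y => ψ t y - p t y) 0 x))
        ≤ ENNReal.ofReal (1 / 2) *
            ⨅ c : ℝ, ∫⁻ x in Set.Ioi xf,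
              ENNReal.ofReal (energyDensity (U ℓ) (fun t y => φ t y - c * u y) 0 x) := by
          gcongr
      _ ≤ farChannelEnergy (U ℓ) xf φ atTop + farChannelEnergy (U ℓ) xf φ atBot := hclose
      _ ≤ farChannelEnergy V xf ψ atTop + farChannelEnergy V xf ψ atBot := add_le_add hTop hBot

/-! ## §4 PROVED: near ∧ far ⇒ K1R (uniform glue by domain of dependence) -/

/-- **K1R follows from its two half-line versions with uniform constants** (`ρ₀ = max`,
`C = max`, `c = min`).  The exterior region `{ρ + |t| < |x − xc|}` is the disjoint union of the far
component `{xc + ρ + |t| < x}` and the near component `{x < xc − ρ − |t|}`; the kernel `rwKernel`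
on the two-component cone is the product of the one-sided kernels (glue `p = if x ≤ xc then p_near
else p_far`, `C²`, a solution and `t`-polynomial on each OPEN component), so the two-sided deficit
is at most the sum of the one-sided ones; the exterior energy is `E_far + E_near`, each monotone in
`|t|` (finite speed of propagation, `Literature.Analysis.PDE.wave1D_{far,near}Energy_mono_*`), so
`liminf E_far + liminf E_near ≤ liminf E_ext` at `±∞`.  (Uniform-constant version of the landed
per-mode `Theorems.fixedModeChannels_of_near_far`, whose witnesses are hidden in `∃` and cannot be
reused; same proof.) -/
theorem uniform_of_near_far (hnear : NearLogEdgeChannels) (hfar : FarLogEdgeChannels) :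
    ∀ M : ℝ, 0 < M → ∃ ρ₀ : ℝ, 0 ≤ ρ₀ ∧ ∃ C : ℝ, 0 ≤ C ∧ ∃ c : ℝ, 0 < c ∧
      ∀ (r : ℝ → ℝ) (xc : ℝ), IsTortoiseRadius M r xc → ∀ (s ℓ : ℕ), s ≤ 2 → s ≤ ℓ →
        ∀ ρ : ℝ, ρ₀ + C * Real.log ((ℓ : ℝ) + 1) ≤ ρ →
          ChannelInequality (linePotential M s ℓ r) xc ρ c := by
  intro M hM
  obtain ⟨ρn, hρn0, Cn, hCn0, cn, hcn, Hn⟩ := hnear M hM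
  obtain ⟨ρf, hρf0, Cf, hCf0, cf, hcf, Hf⟩ := hfar M hM
  refine ⟨max ρn ρf, hρn0.trans (le_max_left _ _), max Cn Cf, hCn0.trans (le_max_left _ _),
    min cn cf, lt_min hcn hcf, ?_⟩
  intro r xc hr s ℓ hs hsℓ ρ hρ ψ hψ
  have hρn : ρn + Cn * Real.log ((ℓ : ℝ) + 1) ≤ ρ :=
    threshold_mono (le_max_left _ _) (le_max_left _ _) hρ
  have hρf : ρf + Cf * Real.log ((ℓ : ℝ) + 1) ≤ ρ :=
    threshold_mono (le_max_right _ _) (le_max_right _ _) hρ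
  have hρ0 : 0 ≤ ρ := by
    have := mul_nonneg hCn0 (log_succ_nonneg ℓ)
    linarith
  set V : ℝ → ℝ := linePotential M s ℓ r with hVdef
  -- the potential: continuity and sign; the solution
  have hVc : Continuous V := continuous_linePotential s ℓ hr.continuous fun x => (hr.pos x).ne'
  have hV0 : ∀ x, 0 ≤ V x := linePotential_nonneg hr.mass_pos.le hsℓ hr.two_mul_lt
  have hψ2 : ContDiff ℝ 2 (Function.uncurry ψ) := hψ.1
  have hsol' : ∀ t x, iteratedDeriv 2 (fun τ => ψ τ x) t - iteratedDeriv 2 (ψ t) x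
      + V x * ψ t x = 0 := fun t x => hψ.2 (t, x)
  -- one-sided energies, kernels and initial deviations
  set Ef : ℝ → ℝ≥0∞ := fun t => ∫⁻ x in Ioi (xc + ρ + |t|), ENNReal.ofReal (energyDensity V ψ t x)
    with hEf
  set En : ℝ → ℝ≥0∞ := fun t => ∫⁻ x in Iio (xc - ρ - |t|), ENNReal.ofReal (energyDensity V ψ t x)
    with hEn
  set Ωf : Set (ℝ × ℝ) := {z | xc + ρ + |z.1| < z.2} with hΩf
  set Ωn : Set (ℝ × ℝ) := {z | z.2 < xc - ρ - |z.1|} with hΩn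
  set Pf : Set (ℝ → ℝ → ℝ) := {p | IsSolutionOn V p Ωf ∧ IsPolynomialInTimeOn p Ωf} with hPf
  set Pn : Set (ℝ → ℝ → ℝ) := {p | IsSolutionOn V p Ωn ∧ IsPolynomialInTimeOn p Ωn} with hPn
  set If : (ℝ → ℝ → ℝ) → ℝ≥0∞ := fun p =>
    ∫⁻ x in Ioi (xc + ρ), ENNReal.ofReal (energyDensity V (fun t y => ψ t y - p t y) 0 x) with hIf
  set In : (ℝ → ℝ → ℝ) → ℝ≥0∞ := fun p =>
    ∫⁻ x in Iio (xc - ρ), ENNReal.ofReal (energyDensity V (fun t y => ψ t y - p t y) 0 x) with hIn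
  set I : (ℝ → ℝ → ℝ) → ℝ≥0∞ := fun p =>
    ∫⁻ x in {x : ℝ | ρ < |x - xc|}, ENNReal.ofReal (energyDensity V (fun t y => ψ t y - p t y) 0 x)
    with hI
  have HF : ENNReal.ofReal cf * (⨅ p ∈ Pf, If p) ≤ liminf Ef atTop + liminf Ef atBot :=
    Hf r xc hr s ℓ hs hsℓ ρ hρf ψ hψ
  have HN : ENNReal.ofReal cn * (⨅ p ∈ Pn, In p) ≤ liminf En atTop + liminf En atBot :=
    Hn r xc hr s ℓ hs hsℓ ρ hρn ψ hψ
  -- (A) monotonicity of the one-sided energies (finite speed of propagation)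
  have hEf_anti : AntitoneOn Ef (Ici 0) := fun a ha b _ hab =>
    wave1D_farEnergy_mono_of_nonneg (V := V) hVc hV0 hψ2 hsol' (xc + ρ) ha hab
  have hEf_mono : MonotoneOn Ef (Iic 0) := fun a _ b hb hab =>
    wave1D_farEnergy_mono_of_nonpos (V := V) hVc hV0 hψ2 hsol' (xc + ρ) hb hab
  have hEn_anti : AntitoneOn En (Ici 0) := fun a ha b _ hab =>
    wave1D_nearEnergy_mono_of_nonneg (V := V) hVc hV0 hψ2 hsol' (xc - ρ) ha hab
  have hEn_mono : MonotoneOn En (Iic 0) := fun a _ b hb hab =>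
    wave1D_nearEnergy_mono_of_nonpos (V := V) hVc hV0 hψ2 hsol' (xc - ρ) hb hab
  -- (B) the exterior region splits into the two components
  have hsplit : ∀ u : ℝ, 0 ≤ u →
      {x : ℝ | u < |x - xc|} = Ioi (xc + u) ∪ Iio (xc - u) := by
    intro u hu
    ext x
    simp only [mem_setOf_eq, mem_union, mem_Ioi, mem_Iio]
    constructor
    · intro h
      rcases le_or_gt 0 (x - xc) with hx | hx
      · rw [abs_of_nonneg hx] at h; left; linarith
      · rw [abs_of_neg hx] at h; right; linarith
    · rintro (h | h)
      · exact lt_of_lt_of_le (by linarith) (le_abs_self _)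
      · exact lt_of_lt_of_le (by linarith) (neg_le_abs _)
  have hdisj : ∀ u : ℝ, 0 ≤ u → Disjoint (Ioi (xc + u)) (Iio (xc - u)) := fun u hu =>
    Set.disjoint_left.2 fun x hx hx' => by
      simp only [mem_Ioi, mem_Iio] at hx hx'; linarith
  have hEext : exteriorEnergy V xc ρ ψ = fun t => Ef t + En t := by
    funext t
    have hu : 0 ≤ ρ + |t| := add_nonneg hρ0 (abs_nonneg t)
    show (∫⁻ x in {x : ℝ | ρ + |t| < |x - xc|}, ENNReal.ofReal (energyDensity V ψ t x)) = Ef t + En t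
    rw [hsplit _ hu, lintegral_union measurableSet_Iio (hdisj _ hu)]
    simp only [hEf, hEn, add_assoc, sub_sub]
  have htop : liminf Ef atTop + liminf En atTop ≤ liminf (exteriorEnergy V xc ρ ψ) atTop := by
    rw [hEext]; exact add_liminf_le_liminf_add_of_antitoneOn hEf_anti hEn_anti
  have hbot : liminf Ef atBot + liminf En atBot ≤ liminf (exteriorEnergy V xc ρ ψ) atBot := by
    rw [hEext]; exact add_liminf_le_liminf_add_of_monotoneOn hEf_mono hEn_mono
  -- (C) the kernel is a product: glueing one-sided kernel elements
  have hΩf_open : IsOpen Ωf := isOpen_lt (by fun_prop) continuous_snd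
  have hΩn_open : IsOpen Ωn := isOpen_lt continuous_snd (by fun_prop)
  have hfar_of_mem : ∀ z : ℝ × ℝ, z ∈ exteriorCone xc ρ → z ∈ Ωf ∨ z ∈ Ωn := by
    intro z hz
    have hz' : ρ + |z.1| < |z.2 - xc| := hz
    rcases le_or_gt 0 (z.2 - xc) with h | h
    · left; rw [abs_of_nonneg h] at hz'; show xc + ρ + |z.1| < z.2; linarith
    · right; rw [abs_of_neg h] at hz'; show z.2 < xc - ρ - |z.1|; linarith
  have key : (⨅ p ∈ rwKernel V xc ρ, I p) ≤ (⨅ p ∈ Pf, If p) + (⨅ p ∈ Pn, In p) := by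
    simp_rw [ENNReal.iInf_add, ENNReal.add_iInf]
    refine le_iInf fun pf => le_iInf fun hpf => le_iInf fun pn => le_iInf fun hpn => ?_
    obtain ⟨⟨hpf1, hpf2⟩, Nf, af, hpf3⟩ := hpf
    obtain ⟨⟨hpn1, hpn2⟩, Nn, an, hpn3⟩ := hpn
    set g : ℝ → ℝ → ℝ := fun t x => if x ≤ xc then pn t x else pf t x with hg
    -- local agreement of the glued function with the pieces
    have hg_far : ∀ x, xc < x → ∀ t, g t x = pf t x := fun x hx t => by
      simp only [hg, if_neg (not_le.2 hx)]
    have hg_near : ∀ x, x < xc → ∀ t, g t x = pn t x := fun x hx t => by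
      simp only [hg, if_pos hx.le]
    have hg_far_ev : ∀ t x, xc < x → (g t) =ᶠ[𝓝 x] (pf t) := fun t x hx =>
      (eventually_gt_nhds hx).mono fun y hy => hg_far y hy t
    have hg_near_ev : ∀ t x, x < xc → (g t) =ᶠ[𝓝 x] (pn t) := fun t x hx =>
      (eventually_lt_nhds hx).mono fun y hy => hg_near y hy t
    have hxfar : ∀ z : ℝ × ℝ, z ∈ Ωf → xc < z.2 := fun z hz => by
      have h : xc + ρ + |z.1| < z.2 := hz
      linarith [abs_nonneg z.1]
    have hxnear : ∀ z : ℝ × ℝ, z ∈ Ωn → z.2 < xc := fun z hz => by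
      have h : z.2 < xc - ρ - |z.1| := hz
      linarith [abs_nonneg z.1]
    have hgP : g ∈ rwKernel V xc ρ := by
      refine ⟨?_, ?_, ?_⟩
      · -- C² on the two-component cone
        intro z hz
        rcases hfar_of_mem z hz with hzf | hzn
        · have h1 : ContDiffAt ℝ 2 (Function.uncurry pf) z :=
            hpf1.contDiffAt (hΩf_open.mem_nhds hzf)
          have h2 : Function.uncurry g =ᶠ[𝓝 z] Function.uncurry pf := by
            have : ∀ᶠ w : ℝ × ℝ in 𝓝 z, xc < w.2 :=
              (isOpen_lt continuous_const continuous_snd).mem_nhds (hxfar z hzf)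
            exact this.mono fun w hw => hg_far w.2 hw w.1
          exact (h1.congr_of_eventuallyEq h2).contDiffWithinAt
        · have h1 : ContDiffAt ℝ 2 (Function.uncurry pn) z :=
            hpn1.contDiffAt (hΩn_open.mem_nhds hzn)
          have h2 : Function.uncurry g =ᶠ[𝓝 z] Function.uncurry pn := by
            have : ∀ᶠ w : ℝ × ℝ in 𝓝 z, w.2 < xc :=
              (isOpen_lt continuous_snd continuous_const).mem_nhds (hxnear z hzn)
            exact this.mono fun w hw => hg_near w.2 hw w.1
          exact (h1.congr_of_eventuallyEq h2).contDiffWithinAt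
      · -- a solution on the cone
        intro z hz
        rcases hfar_of_mem z hz with hzf | hzn
        · have hsolf : iteratedDeriv 2 (fun τ => pf τ z.2) z.1 - iteratedDeriv 2 (pf z.1) z.2
              + V z.2 * pf z.1 z.2 = 0 := hpf2 z hzf
          show iteratedDeriv 2 (fun τ => g τ z.2) z.1 - iteratedDeriv 2 (g z.1) z.2
              + V z.2 * g z.1 z.2 = 0
          have e1 : (fun τ => g τ z.2) = fun τ => pf τ z.2 := funext (hg_far z.2 (hxfar z hzf))
          rw [e1, (hg_far_ev z.1 z.2 (hxfar z hzf)).iteratedDeriv_eq, hg_far z.2 (hxfar z hzf)]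
          exact hsolf
        · have hsoln : iteratedDeriv 2 (fun τ => pn τ z.2) z.1 - iteratedDeriv 2 (pn z.1) z.2
              + V z.2 * pn z.1 z.2 = 0 := hpn2 z hzn
          show iteratedDeriv 2 (fun τ => g τ z.2) z.1 - iteratedDeriv 2 (g z.1) z.2
              + V z.2 * g z.1 z.2 = 0
          have e1 : (fun τ => g τ z.2) = fun τ => pn τ z.2 :=
            funext (hg_near z.2 (hxnear z hzn))
          rw [e1, (hg_near_ev z.1 z.2 (hxnear z hzn)).iteratedDeriv_eq,
            hg_near z.2 (hxnear z hzn)]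
          exact hsoln
      · -- polynomial in `t` on the cone
        refine ⟨Nf + Nn, fun i x => if x ≤ xc then (if i < Nn then an i x else 0)
          else (if i < Nf then af i x else 0), ?_⟩
        intro z hz
        rcases hfar_of_mem z hz with hzf | hzn
        · have hx := hxfar z hzf
          calc g z.1 z.2 = pf z.1 z.2 := hg_far z.2 hx z.1
            _ = ∑ i ∈ Finset.range Nf, af i z.2 * z.1 ^ i := hpf3 z hzf
            _ = ∑ i ∈ Finset.range Nf, (if i < Nf then af i z.2 else 0) * z.1 ^ i :=
                Finset.sum_congr rfl fun i hi => by rw [if_pos (Finset.mem_range.1 hi)]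
            _ = ∑ i ∈ Finset.range (Nf + Nn), (if i < Nf then af i z.2 else 0) * z.1 ^ i := by
                refine Finset.sum_subset (Finset.range_subset_range.2 (Nat.le_add_right _ _)) ?_
                intro i _ hi
                rw [if_neg (fun h => hi (Finset.mem_range.2 h)), zero_mul]
            _ = _ := Finset.sum_congr rfl fun i _ => by simp only [if_neg (not_le.2 hx)]
        · have hx := hxnear z hzn
          calc g z.1 z.2 = pn z.1 z.2 := hg_near z.2 hx z.1
            _ = ∑ i ∈ Finset.range Nn, an i z.2 * z.1 ^ i := hpn3 z hzn
            _ = ∑ i ∈ Finset.range Nn, (if i < Nn then an i z.2 else 0) * z.1 ^ i :=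
                Finset.sum_congr rfl fun i hi => by rw [if_pos (Finset.mem_range.1 hi)]
            _ = ∑ i ∈ Finset.range (Nf + Nn), (if i < Nn then an i z.2 else 0) * z.1 ^ i := by
                refine Finset.sum_subset (Finset.range_subset_range.2 (Nat.le_add_left _ _)) ?_
                intro i _ hi
                rw [if_neg (fun h => hi (Finset.mem_range.2 h)), zero_mul]
            _ = _ := Finset.sum_congr rfl fun i _ => by simp only [if_pos hx.le]
    -- the initial deviation energy of the glued element splits
    have hIg : I g = If pf + In pn := by
      have hfar_int : EqOn (fun x => ENNReal.ofReal (energyDensity V (fun t y => ψ t y - g t y) 0 x))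
          (fun x => ENNReal.ofReal (energyDensity V (fun t y => ψ t y - pf t y) 0 x))
          (Ioi (xc + ρ)) := by
        intro x hx
        have hx' : xc < x := by have h : xc + ρ < x := hx; linarith
        show ENNReal.ofReal (deriv (fun τ => ψ τ x - g τ x) 0 ^ 2
            + deriv (fun y => ψ 0 y - g 0 y) x ^ 2 + V x * (ψ 0 x - g 0 x) ^ 2)
          = ENNReal.ofReal (deriv (fun τ => ψ τ x - pf τ x) 0 ^ 2
            + deriv (fun y => ψ 0 y - pf 0 y) x ^ 2 + V x * (ψ 0 x - pf 0 x) ^ 2)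
        have e1 : (fun τ => ψ τ x - g τ x) = fun τ => ψ τ x - pf τ x :=
          funext fun τ => by rw [hg_far x hx' τ]
        have e2 : (fun y => ψ 0 y - g 0 y) =ᶠ[𝓝 x] fun y => ψ 0 y - pf 0 y :=
          (hg_far_ev 0 x hx').mono fun y hy => by simp only [hy]
        rw [e1, e2.deriv_eq, hg_far x hx' 0]
      have hnear_int : EqOn (fun x => ENNReal.ofReal (energyDensity V (fun t y => ψ t y - g t y) 0 x))
          (fun x => ENNReal.ofReal (energyDensity V (fun t y => ψ t y - pn t y) 0 x))
          (Iio (xc - ρ)) := by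
        intro x hx
        have hx' : x < xc := by have h : x < xc - ρ := hx; linarith
        show ENNReal.ofReal (deriv (fun τ => ψ τ x - g τ x) 0 ^ 2
            + deriv (fun y => ψ 0 y - g 0 y) x ^ 2 + V x * (ψ 0 x - g 0 x) ^ 2)
          = ENNReal.ofReal (deriv (fun τ => ψ τ x - pn τ x) 0 ^ 2
            + deriv (fun y => ψ 0 y - pn 0 y) x ^ 2 + V x * (ψ 0 x - pn 0 x) ^ 2)
        have e1 : (fun τ => ψ τ x - g τ x) = fun τ => ψ τ x - pn τ x :=
          funext fun τ => by rw [hg_near x hx' τ]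
        have e2 : (fun y => ψ 0 y - g 0 y) =ᶠ[𝓝 x] fun y => ψ 0 y - pn 0 y :=
          (hg_near_ev 0 x hx').mono fun y hy => by simp only [hy]
        rw [e1, e2.deriv_eq, hg_near x hx' 0]
      show (∫⁻ x in {x : ℝ | ρ < |x - xc|},
          ENNReal.ofReal (energyDensity V (fun t y => ψ t y - g t y) 0 x)) = If pf + In pn
      rw [hsplit ρ hρ0, lintegral_union measurableSet_Iio (hdisj ρ hρ0),
        setLIntegral_congr_fun measurableSet_Ioi hfar_int,
        setLIntegral_congr_fun measurableSet_Iio hnear_int]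
    calc (⨅ p ∈ rwKernel V xc ρ, I p) ≤ I g := biInf_le I hgP
      _ = If pf + In pn := hIg
  -- (D) assemble
  show ENNReal.ofReal (min cn cf) * (⨅ p ∈ rwKernel V xc ρ, I p)
    ≤ liminf (exteriorEnergy V xc ρ ψ) atTop + liminf (exteriorEnergy V xc ρ ψ) atBot
  calc ENNReal.ofReal (min cn cf) * (⨅ p ∈ rwKernel V xc ρ, I p)
      ≤ ENNReal.ofReal (min cn cf) * ((⨅ p ∈ Pf, If p) + (⨅ p ∈ Pn, In p)) := by gcongr
    _ = ENNReal.ofReal (min cn cf) * (⨅ p ∈ Pf, If p)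
        + ENNReal.ofReal (min cn cf) * (⨅ p ∈ Pn, In p) := mul_add _ _ _
    _ ≤ ENNReal.ofReal cf * (⨅ p ∈ Pf, If p) + ENNReal.ofReal cn * (⨅ p ∈ Pn, In p) := by
        gcongr
        · exact min_le_right _ _
        · exact min_le_left _ _
    _ ≤ (liminf Ef atTop + liminf Ef atBot) + (liminf En atTop + liminf En atBot) := add_le_add HF HN
    _ = (liminf Ef atTop + liminf En atTop) + (liminf Ef atBot + liminf En atBot) :=
        add_add_add_comm _ _ _ _
    _ ≤ liminf (exteriorEnergy V xc ρ ψ) atTop + liminf (exteriorEnergy V xc ρ ψ) atBot :=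
        add_le_add htop hbot

/-! ## §5 The composition: the five stub STATEMENTS imply K1R, and the five registered
stubs conclude it BY NAME -/

/-- **K1R (its body — `Iff.rfl` with the route decl) from the five stub STATEMENTS** —
the composition in the form `stub₁-statement → … → stub₅-statement → crux`: the hypotheses are
VERBATIM the statements of `stub_nearLogEdgeChannels`, `stub_ladderExists`, `stub_residualSubHardy`,
`stub_peel`, `stub_kernelOneChannels` (in this order).  (The conclusion is spelled as the crux's
body so that exactly ONE theorem of this file, `UniformPhotonSphereChannelsR_of` below, concludes
the route decl by name, as the skeleton audit requires.) -/
theorem uniformR_of_statements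
    (hN :
      ∀ M : ℝ, 0 < M → ∃ ρ₀ : ℝ, 0 ≤ ρ₀ ∧ ∃ C : ℝ, 0 ≤ C ∧ ∃ c : ℝ, 0 < c ∧
        ∀ (r : ℝ → ℝ) (xc : ℝ), IsTortoiseRadius M r xc → ∀ (s ℓ : ℕ), s ≤ 2 → s ≤ ℓ →
          ∀ ρ : ℝ, ρ₀ + C * Real.log ((ℓ : ℝ) + 1) ≤ ρ →
            ∀ ψ : ℝ → ℝ → ℝ, IsRWSolution M s ℓ r ψ →
              ENNReal.ofReal c *
                  (⨅ p ∈ {p : ℝ → ℝ → ℝ |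
                      IsSolutionOn (linePotential M s ℓ r) p {z : ℝ × ℝ | z.2 < xc - ρ - |z.1|} ∧
                        IsPolynomialInTimeOn p {z : ℝ × ℝ | z.2 < xc - ρ - |z.1|}},
                    ∫⁻ x in Set.Iio (xc - ρ), ENNReal.ofReal
                      (energyDensity (linePotential M s ℓ r) (fun t y => ψ t y - p t y) 0 x))
                ≤ liminf (fun t => ∫⁻ x in Set.Iio (xc - ρ - |t|),
                      ENNReal.ofReal (energyDensity (linePotential M s ℓ r) ψ t x)) atTop
                  + liminf (fun t => ∫⁻ x in Set.Iio (xc - ρ - |t|),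
                      ENNReal.ofReal (energyDensity (linePotential M s ℓ r) ψ t x)) atBot )
    (hE :
      ∀ M : ℝ, 0 < M → ∃ ρ₁ : ℝ, 0 ≤ ρ₁ ∧ ∃ C₁ : ℝ, 0 ≤ C₁ ∧
        ∀ (r : ℝ → ℝ) (xc : ℝ), IsTortoiseRadius M r xc → ∀ (s ℓ : ℕ), s ≤ 2 → s ≤ ℓ →
          ∀ ρ : ℝ, ρ₁ + C₁ * Real.log ((ℓ : ℝ) + 1) ≤ ρ →
            ∃ (W U : ℕ → ℝ → ℝ) (a : ℝ), a < xc + ρ ∧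
              (∀ x, a < x → U 0 x = linePotential M s ℓ r x) ∧
              (∀ k, k < ℓ → ∀ x, a < x → HasDerivAt (W k) (U k x - W k x ^ 2) x) ∧
              (∀ k, k < ℓ → ∀ x, a < x → U (k + 1) x = 2 * W k x ^ 2 - U k x) ∧
              (∀ k, k < ℓ → Tendsto (fun x => x * W k x) atTop (𝓝 ((k : ℝ) - ℓ))) ∧
              ContDiffOn ℝ 1 (U ℓ) (Set.Ioi a) )
    (hR :
      ∀ M : ℝ, 0 < M → ∃ ρ₂ : ℝ, 0 ≤ ρ₂ ∧ ∃ C₂ : ℝ, 0 ≤ C₂ ∧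
        ∀ (r : ℝ → ℝ) (xc : ℝ), IsTortoiseRadius M r xc → ∀ (s ℓ : ℕ), s ≤ 2 → s ≤ ℓ →
          ∀ ρ : ℝ, ρ₂ + C₂ * Real.log ((ℓ : ℝ) + 1) ≤ ρ →
            ∀ (W U : ℕ → ℝ → ℝ) (a : ℝ), a < xc + ρ →
              (∀ x, a < x → U 0 x = linePotential M s ℓ r x) →
              (∀ k, k < ℓ → ∀ x, a < x → HasDerivAt (W k) (U k x - W k x ^ 2) x) →
              (∀ k, k < ℓ → ∀ x, a < x → U (k + 1) x = 2 * W k x ^ 2 - U k x) →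
              (∀ k, k < ℓ → Tendsto (fun x => x * W k x) atTop (𝓝 ((k : ℝ) - ℓ))) →
              (∃ a' : ℝ, a ≤ a' ∧ a' < xc + ρ ∧ ∀ x, a' < x → 0 ≤ U ℓ x) ∧
              AntitoneOn (U ℓ) (Set.Ici (xc + ρ)) ∧
                ∀ t : ℝ, 0 < t → t ^ 2 * U ℓ (xc + ρ + t) ≤ 1 / 16 )
    (hP :
      ∀ (M : ℝ) (r : ℝ → ℝ) (xc : ℝ), IsTortoiseRadius M r xc → ∀ (s ℓ : ℕ), s ≤ 2 → s ≤ ℓ →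
        ∀ (W U : ℕ → ℝ → ℝ) (a : ℝ),
          (∀ x, a < x → U 0 x = linePotential M s ℓ r x) →
          (∀ k, k < ℓ → ∀ x, a < x → HasDerivAt (W k) (U k x - W k x ^ 2) x) →
          (∀ k, k < ℓ → ∀ x, a < x → U (k + 1) x = 2 * W k x ^ 2 - U k x) →
          (∀ k, k < ℓ → Tendsto (fun x => x * W k x) atTop (𝓝 ((k : ℝ) - ℓ))) →
          (∀ x, a < x → 0 ≤ U ℓ x) →
          ∀ xf : ℝ, a < xf → ∀ ψ : ℝ → ℝ → ℝ, IsRWSolution M s ℓ r ψ →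
            farEnergy (linePotential M s ℓ r) xf ψ 0 ≠ ⊤ →
            ∃ (φ : ℝ → ℝ → ℝ) (u : ℝ → ℝ),
              ContDiffOn ℝ 2 (Function.uncurry φ) {z : ℝ × ℝ | a < z.2} ∧
              (∀ z : ℝ × ℝ, a < z.2 → IsSolutionAt (U ℓ) φ z) ∧
              farEnergy (U ℓ) xf φ 0 ≠ ⊤ ∧
              ContDiffOn ℝ 2 u (Set.Ioi a) ∧
              (∀ x, a < x → iteratedDeriv 2 u x = U ℓ x * u x) ∧
              (∫⁻ x in Set.Ioi xf, ENNReal.ofReal (deriv u x ^ 2 + U ℓ x * u x ^ 2)) ≠ ⊤ ∧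
              u xf ≠ 0 ∧
              farChannelEnergy (U ℓ) xf φ atTop ≤ farChannelEnergy (linePotential M s ℓ r) xf ψ atTop ∧
              farChannelEnergy (U ℓ) xf φ atBot ≤ farChannelEnergy (linePotential M s ℓ r) xf ψ atBot ∧
              (⨅ p ∈ {p : ℝ → ℝ → ℝ |
                  IsSolutionOn (linePotential M s ℓ r) p {z : ℝ × ℝ | xf + |z.1| < z.2} ∧
                    IsPolynomialInTimeOn p {z : ℝ × ℝ | xf + |z.1| < z.2}},
                ∫⁻ x in Set.Ioi xf, ENNReal.ofReal
                  (energyDensity (linePotential M s ℓ r) (fun t y => ψ t y - p t y) 0 x))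
                ≤ ⨅ c : ℝ, ∫⁻ x in Set.Ioi xf, ENNReal.ofReal
                  (energyDensity (U ℓ) (fun t y => φ t y - c * u y) 0 x) )
    (hK :
      ∀ (Q : ℝ → ℝ) (a xf : ℝ), a < xf → ContDiffOn ℝ 1 Q (Set.Ioi a) → (∀ x, a < x → 0 ≤ Q x) →
        AntitoneOn Q (Set.Ici xf) →
        (∀ t : ℝ, 0 < t → t ^ 2 * Q (xf + t) ≤ 1 / 16) →
        ∀ u : ℝ → ℝ, ContDiffOn ℝ 2 u (Set.Ioi a) →
          (∀ x, a < x → iteratedDeriv 2 u x = Q x * u x) →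
          (∫⁻ x in Set.Ioi xf, ENNReal.ofReal (deriv u x ^ 2 + Q x * u x ^ 2)) ≠ ⊤ → u xf ≠ 0 →
          ∀ φ : ℝ → ℝ → ℝ, ContDiffOn ℝ 2 (Function.uncurry φ) {z : ℝ × ℝ | a < z.2} →
            (∀ z : ℝ × ℝ, a < z.2 → IsSolutionAt Q φ z) → farEnergy Q xf φ 0 ≠ ⊤ →
            ENNReal.ofReal (1 / 2) *
                (⨅ c : ℝ, ∫⁻ x in Set.Ioi xf,
                  ENNReal.ofReal (energyDensity Q (fun t y => φ t y - c * u y) 0 x))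
              ≤ farChannelEnergy Q xf φ atTop + farChannelEnergy Q xf φ atBot ) :
    ∀ M : ℝ, 0 < M → ∃ ρ₀ : ℝ, 0 ≤ ρ₀ ∧ ∃ C : ℝ, 0 ≤ C ∧ ∃ c : ℝ, 0 < c ∧
      ∀ (r : ℝ → ℝ) (xc : ℝ), IsTortoiseRadius M r xc → ∀ (s ℓ : ℕ), s ≤ 2 → s ≤ ℓ →
        ∀ ρ : ℝ, ρ₀ + C * Real.log ((ℓ : ℝ) + 1) ≤ ρ →
          ChannelInequality (linePotential M s ℓ r) xc ρ c :=
  uniform_of_near_far hN (farLogEdgeChannels_of hE hR hP hK)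

/-- **The composition: the five registered stubs conclude the crux BY NAME** (closed term over
`stub_*`; the only theorem of this file whose conclusion is literally
`Theses.PhotonSphereChannels.UniformPhotonSphereChannelsR`). -/
theorem UniformPhotonSphereChannelsR_of : UniformPhotonSphereChannelsR :=
  uniformR_of_statements stub_nearLogEdgeChannels stub_ladderExists residualSubHardy_of_stubs
    stub_peel stub_kernelOneChannelsNoMoment

end Summit.FinalStateConjecture.FinalStateConjecture.Cruxes.UniformPhotonSphereChannelsR.CrumPeelingRecessiveTower

end
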